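import Literature.MathematicalPhysics.QuantumFieldTheory.Balaban1983to89.TreeLength

/-!
# `Balaban1983to89.B12ShortestGraph257` — [Balaban1987RG1] p. 257, «a length of a SHORTEST graph in this class»:
the infimum defining the linear size d_j(X) (`TreeLength.treeLen X`) is ATTAINED by an admissible polygonal graph
(kernel proof; `TreeLength` header convention (iii) «The infimum is not shown to be attained» is discharged; v1.1 §8: the
Steiner length `TreeLength.steinerLen` of [Dimock2013BalabanII] App. E is attained as well)

statement-level skeleton of published theorems with citation tags; proofs where landed; nothing here is a claim about
the Yang–Mills mass gap

CITATION HEADER (lean-in-tree rule 2026-08-18).  Source under audit: T. Bałaban, *Renormalization group approach to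
lattice gauge field theories. I. Generation of effective actions in a small field approximation and a coupling
constant renormalization in four dimensions*, Commun. Math. Phys. **109**, 249–301 (1987) [Balaban1987RG1] (cell paper
B12 = "[I]"; held `paper:balaban1987-cmp109-rg-i-small-field`, journal page = PDF page + 248; p. 257 = PDF p. 9).
Satellite of `…Balaban1983to89.TreeLength` (unit b2b-balaban-pv22: unit cubes `cube x`, polygonal graphs = lists of
segments with `carrier`/`len` in the SUP METRIC of [Dimock2013BalabanII] App. E, `Admissible X T`, `treeLen X` = the
infimum of the admissible lengths; its header lists under «(iii) The infimum is not shown to be attained (p. 257 "a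
shortest graph")» exactly the statement proved here) and of `…Balaban1983to89.B12EdgeTreeLength257` (unit
lit-balaban-r09 gen 14: the EDGE class, where attainment is immediate because edge numbers are natural numbers —
`exists_eAdmissible_nedges_eq`; the present file treats the CONTINUUM class of p. 257).  Nothing existing is modified;
imports `TreeLength` only.  Cell records: ROWS-B12 (r09) row B12.Note@257; DIVERGENCE D-T2 (the print names no
metric).  Unit `lit-balaban-r09` gen 15 (reader/typer r09, display owner of B12).

WHAT THE PAPER PRINTS (p. 257, verbatim).  *"Thus every localization domain X is a union of continuous space cubes from
π_j. Consider a class of tree graphs contained in X and intersecting all the cubes in X. A length of a shortest graph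
in this class, divided by M, is the linear size of X, and is denoted by d_j(X). Thus we rescale the space, so that
cubes from π_j become unit cubes, and we take the distance in this scale. Let us stress the fact that we consider
graphs in the continuous space. For a given X usually there are many of these shortest tree graphs."*  The definition
PRESUPPOSES that a shortest graph exists, i.e. that the infimum of the lengths over the (infinite-dimensional) class of
admissible graphs is a minimum; `TreeLength.treeLen` was typed as the infimum, with attainment left open.  The paper
gives no argument; the proof below is ours (elementary: polygonal shortcutting inside cubes, a Steiner sub-structure
of the intersection graph, compactness).

WHAT IS FORMALISED HERE (kernel-checked; sup metric of record, every declaration over the objects of `…TreeLength`).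
* MAIN THEOREM `exists_admissible_len_eq_treeLen`: if X has an admissible graph at all, then some admissible graph T
  has `len T = treeLen X`; `treeLen_mem_lengths`; for every LOCALIZATION DOMAIN (non-empty, face-connected Y)
  `exists_shortest_graph : ∃ T, Admissible Y T ∧ len T = treeLen Y`; and a shortest graph may be taken with at most
  `segBound |X|` = 4|X|² + 2|X| + 1 segments (`exists_shortest_graph_length_le`).
* §1–§2 (PART A, shortcutting) — polygonal PATHS (vertex lists, `pathSegs`), the polygonal triangle inequality, and
  `exists_short_path`: a path whose segments lie in the cubes of X is dominated (same endpoints, inside the cubes of X,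
  not longer) by one with AT MOST 2|X| VERTICES — join the first vertex directly to the LAST later vertex sharing a cube
  with it (that segment lies in the common convex cube), recursively; the resulting `Sparse` path has its
  even-position vertices in pairwise distinct cubes (`Sparse.length_le`).
* §3 — topological ⇒ combinatorial connectedness: a finite family of non-empty closed sets with preconnected union has
  a connected intersection graph (`reflTransGen_of_isPreconnected_iUnion`, closed-set separation; the converse is
  Mathlib's `IsConnected.iUnion_of_reflTransGen`).
* §4 (PART D, compactness) — configurations of exactly N segments `Config d N = Fin N → Seg d`: the length is
  continuous (`continuous_len_ofFn`); «lies in the cubes of X», «meets the cube x» and «is connected» are CLOSED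
  conditions (`isClosed_setOf_carrier_subset`, `isClosed_setOf_carrier_meets` — projection along the compact parameter
  interval; `isClosed_setOf_graphConn` — connectedness of the intersection graph is a finite union, over the
  connected edge patterns E ⊆ N × N, of finite intersections of the closed conditions «segments i and j meet»); hence
  the admissible configurations form a compact set (`isCompact_setOf_admissible`) and, after padding shorter graphs
  with degenerate segments (`admissible_pad`), the length attains its minimum over the admissible graphs with at most
  N segments (`exists_min_admissible_length_le`).
* §5 (PART B, purely combinatorial) — a STEINER SUB-STRUCTURE of a finite connected graph (`Good Q S B C`): kept
  vertices B and chains (b, interior, b') of Q-adjacent vertices with kept ends and duplicate-free, pairwise disjoint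
  interiors outside B, connecting all of B; built by a Prim iteration (`Good.step`: walk from a new terminal to the
  structure along a loop-free chain of fresh vertices — `exists_isChain_to_first`, `exists_isChain_nodup` — and SPLIT
  the chain first hit when the walk ends at an interior vertex, `Good.split`/`Good.attach`); n terminals cost at most
  2n + 1 kept vertices and 2n chains (`exists_good`).
* §6 (PART C, realisation) — for the intersection graph of the segments of an admissible T (adjacency `SegAdj`): kept
  segments are kept whole, and each chain is replaced by a PIECE (`Piece`, `exists_piece`): thread points through the
  consecutive intersections (`Thread`, `thread_len`: the threaded path is not longer than the chain's interior, each
  interior segment being used once), shortcut it by §2, and prepend the degenerate segment at its first vertex; the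
  ACCOUNTING `sum_kept_add_sum_interiors_le` (kept segments and chain interiors are distinct members of T) gives
  `exists_admissible_length_le_segBound`: every admissible graph is dominated by an admissible graph with at most
  `segBound |X|` segments.  §7 combines §6 with §4.
* §8 (revision v1.1, append-only; §§0–7 byte-identical to v1.0 = p319026) — the STEINER LENGTH ℓ̃ of
  [Dimock2013BalabanII] App. E («the length of a MINIMAL tree whose vertices are one point from each block in Y and
  possibly other points»; `TreeLength.steinerLen`, revision-v2 header: «NOT asserted in v2: … attainment of the
  infima») IS ATTAINED: `exists_sAdmissible_len_eq_steinerLen`, `exists_steiner_graph` (a minimiser with at most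
  4|Y| + 1 segments).  Same route, two changes: a chain is realised by ONE free segment joining its threaded
  endpoints (`SPiece`, `exists_sAdmissible_length_le`; the general assembly lemma `isConnected_carrier_assembly`),
  and compactness comes from a length bound via the diameter bound (two points of a connected graph are at
  distance ≤ its length — the landed `B12Decay510Window.dist_le_len`, re-derived inline from the capture lemma
  `TreeLength.le_lenIn_closedBall` to keep the imports at `TreeLength`), which confines a Steiner-admissible graph of
  length ≤ L to the sup-ball of radius L + 1 about a corner of a cube of Y (`carrier_subset_closedBall_of_sAdmissible`,
  `exists_min_sAdmissible_length_le`).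

HONEST SCOPE.  (a) METRIC: the statements concern the length functional of record (sup metric, `TreeLength.len`,
cell DIVERGENCE D-T2); the argument uses only convexity of cubes and segments, the triangle inequality and compactness,
so it is norm-agnostic, but only the sup-metric statements are kernel-checked.  (b) Convention (ii) of `TreeLength`
stands: the class is that of connected finite unions of segments («tree graphs» are such unions); the minimiser
produced here is an admissible graph in that sense — pruning it to a tree graph is not formalised, nor is uniqueness
discussed («usually there are many of these shortest tree graphs»).  (c) The Steiner length `TreeLength.steinerLen` of
[Dimock2013BalabanII] App. E (graphs not confined to Y) is treated in §8 (revision v1.1); the «equivalent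
definition» by cube edges is the subject of `B12EdgeTreeLength257` (GAPS G-B12-08) and is not touched here.  (d) Nothing downstream depends on attainment
((0.26)-type sums use `treeLen` through inequalities only); the file closes a definitional presupposition of p. 257.
Value = kernel-checked bookkeeping for a printed definition, NOT summit progress.
-/

namespace Literature.MathematicalPhysics.QuantumFieldTheory.Balaban1983to89.B12ShortestGraph257

noncomputable section

open Literature.MathematicalPhysics.QuantumFieldTheory.Balaban1983to89
open Literature.MathematicalPhysics.QuantumFieldTheory.Balaban1983to89.B13ScaleTransfer
open Literature.MathematicalPhysics.QuantumFieldTheory.Balaban1983to89.TreeLength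
open _root_.Topology Relation

variable {d : ℕ}

/-! ## §0. Two closure lemmas (binder-explicit monotonicity of `Relation.ReflTransGen`) -/

/-- Monotonicity of the reflexive-transitive closure (binder-explicit form). [folklore] -/
private theorem reflTransGen_of_imp {ι : Type*} {r p : ι → ι → Prop} (h : ∀ a b, r a b → p a b) {a b : ι}
    (hab : ReflTransGen r a b) : ReflTransGen p a b := by
  induction hab with
  | refl => exact ReflTransGen.refl
  | tail _ hbc ih => exact ih.tail (h _ _ hbc)

/-- Closure form of monotonicity: steps of `r` that are paths of `p`. [folklore] -/
private theorem reflTransGen_of_imp_rtg {ι : Type*} {r p : ι → ι → Prop} (h : ∀ a b, r a b → ReflTransGen p a b)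
    {a b : ι} (hab : ReflTransGen r a b) : ReflTransGen p a b := by
  induction hab with
  | refl => exact ReflTransGen.refl
  | tail _ hbc ih => exact ih.trans (h _ _ hbc)

/-- Mapping a path of `r` along `f` into paths of `p` (binder-explicit form of `Relation.ReflTransGen.lift`).
[folklore] -/
private theorem reflTransGen_map {ι κ : Type*} {r : ι → ι → Prop} {p : κ → κ → Prop} (f : ι → κ)
    (h : ∀ a b, r a b → ReflTransGen p (f a) (f b)) {a b : ι} (hab : ReflTransGen r a b) :
    ReflTransGen p (f a) (f b) := by
  induction hab with
  | refl => exact ReflTransGen.refl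
  | tail _ hbc ih => exact ih.trans (h _ _ hbc)

/-! ## §1. Polygonal paths: vertex lists, their segments, length, carrier -/

/-- The consecutive segments of a polygonal PATH given by its list of vertices p₀, p₁, …, p_r: the list
[(p₀,p₁), (p₁,p₂), …, (p_{r−1},p_r)] (a graph in the sense of `TreeLength.carrier`/`len`). [cite: Balaban1987RG1, p.257 (linear size d_j, a shortest graph)] -/
def pathSegs : List (RPt d) → List (Seg d)
  | [] => []
  | [_] => []
  | p :: q :: l => (p, q) :: pathSegs (q :: l)

/-- The empty path has no segments. [cite: Balaban1987RG1, p.257 (linear size d_j, a shortest graph)] -/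
@[simp] theorem pathSegs_nil : pathSegs ([] : List (RPt d)) = [] := rfl

/-- A one-vertex path has no segments. [cite: Balaban1987RG1, p.257 (linear size d_j, a shortest graph)] -/
@[simp] theorem pathSegs_singleton (p : RPt d) : pathSegs [p] = [] := rfl

/-- Segments of a path with at least two vertices. [cite: Balaban1987RG1, p.257 (linear size d_j, a shortest graph)] -/
@[simp] theorem pathSegs_cons_cons (p q : RPt d) (l : List (RPt d)) :
    pathSegs (p :: q :: l) = (p, q) :: pathSegs (q :: l) := rfl

/-- Segments of `p :: l` for a non-empty `l`: the first segment joins `p` to the head of `l`. [cite: Balaban1987RG1, p.257 (linear size d_j, a shortest graph)] -/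
theorem pathSegs_cons_of_ne_nil (p : RPt d) {l : List (RPt d)} (hl : l ≠ []) :
    pathSegs (p :: l) = (p, l.head hl) :: pathSegs l := by
  obtain ⟨q, m, rfl⟩ := List.exists_cons_of_ne_nil hl
  rfl

/-- A path with `r + 1` vertices has `r` segments. [cite: Balaban1987RG1, p.257 (linear size d_j, a shortest graph)] -/
theorem length_pathSegs : ∀ (l : List (RPt d)), (pathSegs l).length = l.length - 1
  | [] => rfl
  | [_] => rfl
  | p :: q :: l => by
      rw [pathSegs_cons_cons, List.length_cons, length_pathSegs (q :: l)]
      simp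

/-- POLYGONAL TRIANGLE INEQUALITY: the endpoints of a path are at distance at most its length. [cite: Balaban1987RG1, p.257 (linear size d_j, a shortest graph)] -/
theorem dist_head_getLast_le_len : ∀ (l : List (RPt d)) (h : l ≠ []),
    dist (l.head h) (l.getLast h) ≤ len (pathSegs l)
  | [], h => (h rfl).elim
  | [p], _ => by simp
  | p :: q :: l, _ => by
      have ih := dist_head_getLast_le_len (q :: l) (List.cons_ne_nil _ _)
      simp only [List.head_cons, List.getLast_cons_cons, pathSegs_cons_cons, len_cons] at ih ⊢
      exact (dist_triangle p q _).trans (by linarith)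

/-- The segments of a suffix of a path are segments of the path. [cite: Balaban1987RG1, p.257 (linear size d_j, a shortest graph)] -/
theorem mem_pathSegs_append_right : ∀ (t : List (RPt d)) {s : List (RPt d)} {x : Seg d},
    x ∈ pathSegs s → x ∈ pathSegs (t ++ s)
  | [], _, _, h => h
  | a :: t, s, x, h => by
      have ih := mem_pathSegs_append_right t h
      have hne : t ++ s ≠ [] := by
        intro h0
        rw [h0] at ih
        simp at ih
      rw [List.cons_append, pathSegs_cons_of_ne_nil a hne]
      exact List.mem_cons_of_mem _ ih

/-- Splitting the length of a path at a vertex: for `m = t ++ s` with `s` non-empty, the length of `m` is the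
length of the initial piece `t ++ [head s]` plus the length of `s`. [cite: Balaban1987RG1, p.257 (linear size d_j, a shortest graph)] -/
theorem len_pathSegs_append : ∀ (t : List (RPt d)) {s : List (RPt d)} (hs : s ≠ []),
    len (pathSegs (t ++ s)) = len (pathSegs (t ++ [s.head hs])) + len (pathSegs s)
  | [], s, hs => by simp
  | [a], s, hs => by
      obtain ⟨q, m, rfl⟩ := List.exists_cons_of_ne_nil hs
      simp
  | a :: b :: t, s, hs => by
      have ih := len_pathSegs_append (b :: t) hs
      simp only [List.cons_append, pathSegs_cons_cons, len_cons] at ih ⊢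
      rw [ih]
      ring

/-- The head of `t ++ [head s]` is the head of `t ++ s`. [folklore] -/
private theorem head_append_singleton_head (t : List (RPt d)) {s : List (RPt d)} (hs : s ≠ [])
    (h1 : t ++ [s.head hs] ≠ []) (h2 : t ++ s ≠ []) : (t ++ [s.head hs]).head h1 = (t ++ s).head h2 := by
  cases t with
  | nil => simp
  | cons a t => simp

/-- The carrier of a path together with its first vertex is connected and contains every vertex (for a path
with at least two vertices the first vertex is already on the first segment). [cite: Balaban1987RG1, p.257 (linear size d_j, a shortest graph)] -/
theorem isConnected_insert_carrier_pathSegs : ∀ (l : List (RPt d)) (h : l ≠ []),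
    IsConnected (insert (l.head h) (carrier (pathSegs l))) ∧ ∀ p ∈ l, p ∈ insert (l.head h) (carrier (pathSegs l))
  | [], h => (h rfl).elim
  | [p], _ => by
      refine ⟨by simpa using isConnected_singleton, ?_⟩
      intro q hq
      simp only [List.mem_singleton] at hq
      subst hq
      simp
  | p :: q :: l, _ => by
      obtain ⟨ih1, ih2⟩ := isConnected_insert_carrier_pathSegs (q :: l) (List.cons_ne_nil _ _)
      simp only [List.head_cons] at ih1 ih2 ⊢
      rw [pathSegs_cons_cons, carrier_cons]
      have hp : p ∈ segment ℝ p q := left_mem_segment ℝ p q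
      have hq : q ∈ segment ℝ p q := right_mem_segment ℝ p q
      have hset : insert p (segment ℝ p q ∪ carrier (pathSegs (q :: l))) =
          segment ℝ p q ∪ insert q (carrier (pathSegs (q :: l))) := by
        ext z
        simp only [Set.mem_insert_iff, Set.mem_union]
        constructor
        · rintro (rfl | h | h)
          · exact Or.inl hp
          · exact Or.inl h
          · exact Or.inr (Or.inr h)
        · rintro (h | rfl | h)
          · exact Or.inr (Or.inl h)
          · exact Or.inr (Or.inl hq)
          · exact Or.inr (Or.inr h)
      rw [hset]
      refine ⟨?_, ?_⟩
      · have hseg : IsConnected (segment ℝ p q) :=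
          ⟨⟨p, hp⟩, (convex_segment p q).isPreconnected⟩
        exact hseg.union ⟨q, hq, Set.mem_insert q _⟩ ih1
      · intro z hz
        rcases List.mem_cons.1 hz with rfl | hz
        · exact Or.inl hp
        · exact Or.inr (ih2 z hz)

/-! ## §2. Shortcutting a polygonal path inside the cubes of X -/

/-- Two points SHARE A CUBE of X. [cite: Balaban1987RG1, p.257 (linear size d_j, a shortest graph)] -/
def ShareCube (X : Finset (Pt d)) (p r : RPt d) : Prop := ∃ x ∈ X, p ∈ cube x ∧ r ∈ cube x

/-- The segment joining two points of one cube of X lies in the cubes of X (cubes are convex). [cite: Balaban1987RG1, p.257 (linear size d_j, a shortest graph)] -/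
theorem segment_subset_cubes_of_shareCube {X : Finset (Pt d)} {p r : RPt d} (h : ShareCube X p r) :
    segment ℝ p r ⊆ cubes X := by
  obtain ⟨x, hx, hp, hr⟩ := h
  exact ((convex_cube x).segment_subset hp hr).trans (cube_subset_cubes hx)

/-- SPARSE paths: two vertices at distance ≥ 2 along the path never share a cube of X (the normal form reached by
exhaustive shortcutting). [cite: Balaban1987RG1, p.257 (linear size d_j, a shortest graph)] -/
def Sparse (X : Finset (Pt d)) : List (RPt d) → Prop
  | [] => True
  | [_] => True
  | p :: q :: m => Sparse X (q :: m) ∧ ∀ r ∈ m, ¬ ShareCube X p r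

/-- Dropping the first vertex keeps a path sparse. [cite: Balaban1987RG1, p.257 (linear size d_j, a shortest graph)] -/
theorem Sparse.of_cons {X : Finset (Pt d)} {a : RPt d} : ∀ {m : List (RPt d)}, Sparse X (a :: m) → Sparse X m
  | [], _ => trivial
  | _ :: _, h => h.1

/-- A suffix of a sparse path is sparse. [cite: Balaban1987RG1, p.257 (linear size d_j, a shortest graph)] -/
theorem Sparse.of_append {X : Finset (Pt d)} : ∀ (t : List (RPt d)) {s : List (RPt d)},
    Sparse X (t ++ s) → Sparse X s
  | [], _, h => h
  | _ :: t, _, h => Sparse.of_append t (Sparse.of_cons h)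

/-- Prepending a vertex that shares no cube with the vertices beyond the next one keeps a path sparse. [cite: Balaban1987RG1, p.257 (linear size d_j, a shortest graph)] -/
theorem Sparse.cons {X : Finset (Pt d)} {p : RPt d} : ∀ {s : List (RPt d)},
    Sparse X s → (∀ r ∈ s.tail, ¬ ShareCube X p r) → Sparse X (p :: s)
  | [], _, _ => trivial
  | _ :: _, hs, ht => ⟨hs, ht⟩

/-- Sparseness is antitone in the index set. [cite: Balaban1987RG1, p.257 (linear size d_j, a shortest graph)] -/
theorem Sparse.anti {X X' : Finset (Pt d)} (hX : X' ⊆ X) : ∀ {l : List (RPt d)}, Sparse X l → Sparse X' l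
  | [], _ => trivial
  | [_], _ => trivial
  | p :: q :: m, h => by
      refine ⟨Sparse.anti hX h.1, fun r hr hs => h.2 r hr ?_⟩
      obtain ⟨x, hx, hpx, hrx⟩ := hs
      exact ⟨x, hX hx, hpx, hrx⟩

/-- COUNTING: a sparse path all of whose vertices lie in the cubes of X has at most 2·|X| vertices (the vertices
at even positions lie in pairwise distinct cubes). [cite: Balaban1987RG1, p.257 (linear size d_j, a shortest graph)] -/
theorem Sparse.length_le : ∀ (n : ℕ) (X : Finset (Pt d)) (l : List (RPt d)), l.length ≤ n → Sparse X l →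
    (∀ p ∈ l, p ∈ cubes X) → l.length ≤ 2 * X.card := by
  intro n
  induction n with
  | zero =>
      intro X l hl _ _
      have : l.length = 0 := Nat.le_zero.1 hl
      omega
  | succ n ih =>
      intro X l hl hS hv
      match l, hl, hS, hv with
      | [], _, _, _ => simp
      | [p], _, _, hv =>
          obtain ⟨x, hx, -⟩ := mem_cubes.1 (hv p (by simp))
          have : 1 ≤ X.card := Finset.card_pos.2 ⟨x, hx⟩
          simp only [List.length_singleton]
          omega
      | p :: q :: m, hl, hS, hv =>
          obtain ⟨xp, hxp, hpxp⟩ := mem_cubes.1 (hv p (by simp))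
          have hm : ∀ r ∈ m, r ∈ cubes (X.erase xp) := by
            intro r hr
            obtain ⟨x, hx, hrx⟩ := mem_cubes.1 (hv r (by simp [hr]))
            refine mem_cubes.2 ⟨x, Finset.mem_erase.2 ⟨?_, hx⟩, hrx⟩
            intro hxe
            exact hS.2 r hr ⟨x, hx, hxe ▸ hpxp, hrx⟩
          have hSm : Sparse (X.erase xp) m := Sparse.anti (Finset.erase_subset xp X) (Sparse.of_cons hS.1)
          have hlen : m.length ≤ n := by
            simp only [List.length_cons] at hl
            omega
          have him := ih (X.erase xp) m hlen hSm hm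
          have hcard : (X.erase xp).card + 1 = X.card := by
            rw [Finset.card_erase_of_mem hxp]
            have : 1 ≤ X.card := Finset.card_pos.2 ⟨xp, hxp⟩
            omega
          simp only [List.length_cons]
          omega

/-- LAST SHARING VERTEX: every path `m` splits as `m = t ++ s` where `s` starts at the LAST vertex of `m` satisfying
`P` (and `s = m` when no vertex does); no vertex of `s` after its head satisfies `P`. [folklore] -/
private theorem exists_split_last (P : RPt d → Prop) : ∀ (m : List (RPt d)),
    ∃ t s : List (RPt d), m = t ++ s ∧ (m ≠ [] → s ≠ []) ∧ (∀ hs : s ≠ [], P (s.head hs) ∨ t = []) ∧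
      ∀ r ∈ s.tail, ¬ P r
  | [] => ⟨[], [], rfl, fun h => (h rfl).elim, fun hs => (hs rfl).elim, by simp⟩
  | r :: u => by
      obtain ⟨t₀, s₀, hu, hne, hhead, htail⟩ := exists_split_last P u
      by_cases h : ∃ r' ∈ u, P r'
      · obtain ⟨r', hr'u, hPr'⟩ := h
        have hu0 : u ≠ [] := List.ne_nil_of_mem hr'u
        have hs0 : s₀ ≠ [] := hne hu0
        refine ⟨r :: t₀, s₀, by rw [hu, List.cons_append], fun _ => hs0, fun hs => Or.inl ?_, htail⟩
        rcases hhead hs with hP | ht0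
        · exact hP
        · -- t₀ = [] : s₀ = u, and r' ∈ u is the head of s₀ or in its tail
          subst ht0
          rw [List.nil_append] at hu
          subst hu
          obtain ⟨a, w, rfl⟩ := List.exists_cons_of_ne_nil hs
          rcases List.mem_cons.1 hr'u with rfl | hw
          · simpa using hPr'
          · exact absurd hPr' (htail r' hw)
      · simp only [not_exists, not_and] at h
        exact ⟨[], r :: u, rfl, fun _ => List.cons_ne_nil _ _, fun _ => Or.inr rfl, fun r' hr' => h r' hr'⟩

/-- SHORTCUTTING (the normal form): a polygonal path whose segments lie in the cubes of X can be replaced by a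
SPARSE path with the same endpoints, whose segments lie in the cubes of X, which is not longer, and whose
vertices are vertices of the original path.  Mechanism: recursively, the first vertex is joined directly to the
LAST later vertex sharing a cube with it (that segment lies in the common cube; the polygonal triangle
inequality bounds its length). [cite: Balaban1987RG1, p.257 (linear size d_j, a shortest graph)] -/
theorem exists_sparse_path (X : Finset (Pt d)) : ∀ (l : List (RPt d)) (hl : l ≠ []),
    (∀ s ∈ pathSegs l, segment ℝ s.1 s.2 ⊆ cubes X) →
    ∃ (l' : List (RPt d)) (hl' : l' ≠ []), l'.head hl' = l.head hl ∧ l'.getLast hl' = l.getLast hl ∧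
      (∀ s ∈ pathSegs l', segment ℝ s.1 s.2 ⊆ cubes X) ∧ Sparse X l' ∧
      len (pathSegs l') ≤ len (pathSegs l) ∧ ∀ p ∈ l', p ∈ l
  | [], hl, _ => (hl rfl).elim
  | [p], _, _ => ⟨[p], List.cons_ne_nil _ _, rfl, rfl, by simp, trivial, le_rfl, fun _ h => h⟩
  | p :: q :: m, _, hX => by
      have hX' : ∀ s ∈ pathSegs (q :: m), segment ℝ s.1 s.2 ⊆ cubes X :=
        fun s hs => hX s (by simp [hs])
      obtain ⟨m', hm', hhead, hlast, hXm', hSm', hlen, hmem⟩ := exists_sparse_path X (q :: m) (List.cons_ne_nil _ _) hX'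
      obtain ⟨t, s, hts, hsne, hsh, hst⟩ := exists_split_last (ShareCube X p) m'
      have hs : s ≠ [] := hsne hm'
      subst hts
      refine ⟨p :: s, List.cons_ne_nil _ _, rfl, ?_, ?_, ?_, ?_, ?_⟩
      · -- last vertex
        simp only [List.getLast_cons_cons]
        rw [List.getLast_cons hs, ← hlast]
        exact (List.getLast_append_of_ne_nil _ hs).symm
      · -- segments in X
        intro s' hs'
        rw [pathSegs_cons_of_ne_nil p hs] at hs'
        rcases List.mem_cons.1 hs' with rfl | hs'
        · rcases hsh hs with hP | ht
          · exact segment_subset_cubes_of_shareCube hP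
          · subst ht
            have hq : s.head hs = q := by simpa using hhead
            have : (p, s.head hs) ∈ pathSegs (p :: q :: m) := by
              rw [hq]
              simp
            exact hX _ this
        · exact hXm' _ (mem_pathSegs_append_right t hs')
      · -- sparse
        exact Sparse.cons (Sparse.of_append t hSm') hst
      · -- length
        rw [pathSegs_cons_of_ne_nil p hs, len_cons, pathSegs_cons_cons, len_cons]
        have h1 : len (pathSegs (t ++ s)) = len (pathSegs (t ++ [s.head hs])) + len (pathSegs s) :=
          len_pathSegs_append t hs
        have hu : t ++ [s.head hs] ≠ [] := by simp
        have h2 := dist_head_getLast_le_len (t ++ [s.head hs]) hu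
        rw [List.getLast_append_of_ne_nil _ (List.cons_ne_nil _ _)] at h2
        simp only [List.getLast_singleton] at h2
        have h3 : (t ++ [s.head hs]).head hu = q := by
          rw [head_append_singleton_head t hs hu hm', hhead]
          rfl
        rw [h3] at h2
        have h4 := dist_triangle p q (s.head hs)
        linarith
      · -- vertices
        intro z hz
        rcases List.mem_cons.1 hz with rfl | hz
        · simp
        · exact List.mem_cons_of_mem _ (hmem z (List.mem_append_right t hz))

/-- PART A: every polygonal path inside the cubes of X is dominated by one with the same endpoints, inside the
cubes of X, not longer, and with AT MOST 2·|X| VERTICES. [cite: Balaban1987RG1, p.257 (linear size d_j, a shortest graph)] -/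
theorem exists_short_path (X : Finset (Pt d)) (l : List (RPt d)) (hl : l ≠ [])
    (hX : ∀ s ∈ pathSegs l, segment ℝ s.1 s.2 ⊆ cubes X) (hv : ∀ p ∈ l, p ∈ cubes X) :
    ∃ (l' : List (RPt d)) (hl' : l' ≠ []), l'.head hl' = l.head hl ∧ l'.getLast hl' = l.getLast hl ∧
      (∀ s ∈ pathSegs l', segment ℝ s.1 s.2 ⊆ cubes X) ∧ len (pathSegs l') ≤ len (pathSegs l) ∧
      l'.length ≤ 2 * X.card := by
  obtain ⟨l', hl', h1, h2, h3, h4, h5, h6⟩ := exists_sparse_path X l hl hX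
  exact ⟨l', hl', h1, h2, h3, h5, Sparse.length_le _ X l' le_rfl h4 fun p hp => hv p (h6 p hp)⟩

/-! ## §3. Connectedness of a finite union of closed sets is a combinatorial condition on the intersection graph -/

/-- TOPOLOGICAL ⇒ COMBINATORIAL CONNECTEDNESS: if a finite family of non-empty closed sets has preconnected union,
then its intersection graph (i ~ j iff s i ∩ s j ≠ ∅) is connected — closed-set separation of the union into the
sets reachable from i and the others. [cite: Balaban1987RG1, p.257 (linear size d_j, a shortest graph)] -/
theorem reflTransGen_of_isPreconnected_iUnion {α ι : Type*} [TopologicalSpace α] [Finite ι] {s : ι → Set α}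
    (hc : IsPreconnected (⋃ i, s i)) (hcl : ∀ i, IsClosed (s i)) (hne : ∀ i, (s i).Nonempty) (i j : ι) :
    ReflTransGen (fun i j => (s i ∩ s j).Nonempty) i j := by
  classical
  set r : ι → ι → Prop := fun i j => (s i ∩ s j).Nonempty with hr
  let U : Set α := ⋃ k ∈ {k | ReflTransGen r i k}, s k
  let W : Set α := ⋃ k ∈ {k | ¬ ReflTransGen r i k}, s k
  have hU : IsClosed U := (Set.toFinite _).isClosed_biUnion fun k _ => hcl k
  have hW : IsClosed W := (Set.toFinite _).isClosed_biUnion fun k _ => hcl k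
  have hcover : (⋃ i, s i) ⊆ U ∪ W := by
    intro z hz
    obtain ⟨k, hk⟩ := Set.mem_iUnion.1 hz
    by_cases h : ReflTransGen r i k
    · exact Or.inl (Set.mem_biUnion (show k ∈ {k | ReflTransGen r i k} from h) hk)
    · exact Or.inr (Set.mem_biUnion (show k ∈ {k | ¬ ReflTransGen r i k} from h) hk)
  have hdisj : (⋃ i, s i) ∩ (U ∩ W) = ∅ := by
    apply Set.eq_empty_of_forall_notMem
    rintro z ⟨-, hzU, hzW⟩
    obtain ⟨k, hk, hzk⟩ := Set.mem_iUnion₂.1 hzU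
    obtain ⟨k', hk', hzk'⟩ := Set.mem_iUnion₂.1 hzW
    exact hk' (hk.tail ⟨z, hzk, hzk'⟩)
  obtain ⟨z₀, hz₀⟩ := hne i
  have hz₀U : z₀ ∈ U := Set.mem_biUnion (show i ∈ {k | ReflTransGen r i k} from ReflTransGen.refl) hz₀
  rcases (isPreconnected_iff_subset_of_disjoint_closed.1 hc) U W hU hW hcover hdisj with h | h
  · obtain ⟨w, hw⟩ := hne j
    obtain ⟨k, hk, hwk⟩ := Set.mem_iUnion₂.1 (h (Set.mem_iUnion.2 ⟨j, hw⟩))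
    exact hk.tail ⟨w, hwk, hw⟩
  · obtain ⟨k', hk', hzk'⟩ := Set.mem_iUnion₂.1 (h (Set.mem_iUnion.2 ⟨i, hz₀⟩))
    exact (hk' (ReflTransGen.single ⟨z₀, hz₀, hzk'⟩)).elim

/-! ## §4. Graphs with a fixed number N of segments: a compact configuration space on which the admissible ones
form a closed set, so that the length attains its minimum -/

/-- A configuration of N segments (the polygonal graph `List.ofFn f`). [cite: Balaban1987RG1, p.257 (linear size d_j, a shortest graph)] -/
abbrev Config (d N : ℕ) := Fin N → Seg d

/-- The carrier of `List.ofFn f` is the union of the N segments. [cite: Balaban1987RG1, p.257 (linear size d_j, a shortest graph)] -/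
theorem mem_carrier_ofFn {N : ℕ} {f : Config d N} {z : RPt d} :
    z ∈ carrier (List.ofFn f) ↔ ∃ i, z ∈ segment ℝ (f i).1 (f i).2 := by
  rw [mem_carrier]
  constructor
  · rintro ⟨s, hs, hz⟩
    obtain ⟨i, rfl⟩ := List.mem_ofFn.1 hs
    exact ⟨i, hz⟩
  · rintro ⟨i, hz⟩
    exact ⟨f i, List.mem_ofFn.2 ⟨i, rfl⟩, hz⟩

/-- The carrier of `List.ofFn f` as an indexed union. [cite: Balaban1987RG1, p.257 (linear size d_j, a shortest graph)] -/
theorem carrier_ofFn {N : ℕ} (f : Config d N) : carrier (List.ofFn f) = ⋃ i, segment ℝ (f i).1 (f i).2 := by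
  ext z
  rw [mem_carrier_ofFn, Set.mem_iUnion]

/-- The length of a graph is the sum of the lengths of its segments (list form). [cite: Balaban1987RG1, p.257 (linear size d_j, a shortest graph)] -/
theorem len_eq_sum_map (T : List (Seg d)) : len T = (T.map fun s => dist s.1 s.2).sum := by
  induction T with
  | nil => simp
  | cons s T ih => simp [ih]

/-- The length of `List.ofFn f` is the finite sum of the N segment lengths. [cite: Balaban1987RG1, p.257 (linear size d_j, a shortest graph)] -/
theorem len_ofFn {N : ℕ} (f : Config d N) : len (List.ofFn f) = ∑ i, dist (f i).1 (f i).2 := by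
  rw [len_eq_sum_map, List.map_ofFn, List.sum_ofFn]
  rfl

/-- The length is a continuous function of the configuration. [cite: Balaban1987RG1, p.257 (linear size d_j, a shortest graph)] -/
theorem continuous_len_ofFn (N : ℕ) : Continuous fun f : Config d N => len (List.ofFn f) := by
  simp only [len_ofFn]
  refine continuous_finsetSum _ fun i _ => ?_
  exact ((continuous_fst.comp (continuous_apply i)).dist (continuous_snd.comp (continuous_apply i)))

/-- The point `gam (f i) t` of the i-th segment depends continuously on (t, f). [cite: Balaban1987RG1, p.257 (linear size d_j, a shortest graph)] -/
theorem continuous_gam_eval {N : ℕ} (i : Fin N) :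
    Continuous fun q : ℝ × Config d N => gam (q.2 i) q.1 := by
  have h1 : Continuous fun q : ℝ × Config d N => (q.2 i).1 :=
    continuous_fst.comp ((continuous_apply i).comp continuous_snd)
  have h2 : Continuous fun q : ℝ × Config d N => (q.2 i).2 :=
    continuous_snd.comp ((continuous_apply i).comp continuous_snd)
  simp only [gam]
  exact h1.add (continuous_fst.smul (h2.sub h1))

/-- The union of the cubes of X is compact. [cite: Balaban1987RG1, p.257 (linear size d_j, a shortest graph)] -/
theorem isCompact_cubes (X : Finset (Pt d)) : IsCompact (cubes X) :=
  X.isCompact_biUnion fun _ _ => isCompact_Icc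

/-- CONTAINMENT IS CLOSED: the configurations whose graph lies in a closed set C form a closed set. [cite: Balaban1987RG1, p.257 (linear size d_j, a shortest graph)] -/
theorem isClosed_setOf_carrier_subset {N : ℕ} {C : Set (RPt d)} (hC : IsClosed C) :
    IsClosed {f : Config d N | carrier (List.ofFn f) ⊆ C} := by
  have hset : {f : Config d N | carrier (List.ofFn f) ⊆ C} =
      ⋂ i, ⋂ t ∈ Set.Icc (0 : ℝ) 1, (fun f : Config d N => gam (f i) t) ⁻¹' C := by
    ext f
    simp only [Set.mem_setOf_eq, carrier_ofFn, Set.iUnion_subset_iff, Set.mem_iInter, Set.mem_preimage,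
      segment_eq_image_gam, Set.image_subset_iff]
    rfl
  rw [hset]
  refine isClosed_iInter fun i => isClosed_biInter fun t _ => ?_
  exact hC.preimage ((continuous_gam_eval i).comp (Continuous.prodMk_right t))

/-- MEETING A CLOSED SET IS CLOSED: the configurations whose graph meets a closed set C form a closed set
(projection along the compact parameter interval [0,1]). [cite: Balaban1987RG1, p.257 (linear size d_j, a shortest graph)] -/
theorem isClosed_setOf_carrier_meets {N : ℕ} {C : Set (RPt d)} (hC : IsClosed C) :
    IsClosed {f : Config d N | (carrier (List.ofFn f) ∩ C).Nonempty} := by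
  have hset : {f : Config d N | (carrier (List.ofFn f) ∩ C).Nonempty} =
      ⋃ i, Prod.snd '' {q : Set.Icc (0 : ℝ) 1 × Config d N | gam (q.2 i) (q.1 : ℝ) ∈ C} := by
    ext f
    simp only [Set.mem_setOf_eq, Set.mem_iUnion, Set.mem_image, Prod.exists, Subtype.exists,
      exists_eq_right]
    constructor
    · rintro ⟨z, hz, hzC⟩
      obtain ⟨i, hzi⟩ := mem_carrier_ofFn.1 hz
      rw [segment_eq_image_gam] at hzi
      obtain ⟨t, ht, rfl⟩ := hzi
      exact ⟨i, t, ht, hzC⟩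
    · rintro ⟨i, t, ht, htC⟩
      refine ⟨gam (f i) t, mem_carrier_ofFn.2 ⟨i, ?_⟩, htC⟩
      rw [segment_eq_image_gam]
      exact ⟨t, ht, rfl⟩
  rw [hset]
  refine isClosed_iUnion_of_finite fun i => ?_
  refine isClosedMap_snd_of_compactSpace _ (hC.preimage ?_)
  exact (continuous_gam_eval i).comp (continuous_subtype_val.prodMap continuous_id)

/-- The INTERSECTION GRAPH of a configuration is connected: every two segments are joined by a chain of
consecutively intersecting segments. [cite: Balaban1987RG1, p.257 (linear size d_j, a shortest graph)] -/
def GraphConn {N : ℕ} (f : Config d N) : Prop :=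
  ∀ i j : Fin N, ReflTransGen (fun i j => (segment ℝ (f i).1 (f i).2 ∩ segment ℝ (f j).1 (f j).2).Nonempty) i j

/-- Two given segments of the configuration intersect: a closed condition (projection along the compact
parameter square). [cite: Balaban1987RG1, p.257 (linear size d_j, a shortest graph)] -/
theorem isClosed_setOf_segments_meet {N : ℕ} (i j : Fin N) :
    IsClosed {f : Config d N | (segment ℝ (f i).1 (f i).2 ∩ segment ℝ (f j).1 (f j).2).Nonempty} := by
  have hset : {f : Config d N | (segment ℝ (f i).1 (f i).2 ∩ segment ℝ (f j).1 (f j).2).Nonempty} =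
      Prod.snd '' {q : (Set.Icc (0 : ℝ) 1 × Set.Icc (0 : ℝ) 1) × Config d N |
        gam (q.2 i) (q.1.1 : ℝ) = gam (q.2 j) (q.1.2 : ℝ)} := by
    ext f
    simp only [Set.mem_setOf_eq, Set.mem_image, Prod.exists, Subtype.exists, exists_eq_right]
    constructor
    · rintro ⟨z, hzi, hzj⟩
      rw [segment_eq_image_gam] at hzi hzj
      obtain ⟨t, ht, rfl⟩ := hzi
      obtain ⟨u, hu, hu'⟩ := hzj
      exact ⟨t, ht, u, hu, hu'.symm⟩
    · rintro ⟨t, ht, u, hu, h⟩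
      refine ⟨gam (f i) t, ?_, ?_⟩
      · rw [segment_eq_image_gam]; exact ⟨t, ht, rfl⟩
      · rw [segment_eq_image_gam, h]; exact ⟨u, hu, rfl⟩
  rw [hset]
  refine isClosedMap_snd_of_compactSpace _ (isClosed_eq ?_ ?_)
  · exact (continuous_gam_eval i).comp
      ((continuous_subtype_val.comp (continuous_fst.comp continuous_fst)).prodMk continuous_snd)
  · exact (continuous_gam_eval j).comp
      ((continuous_subtype_val.comp (continuous_snd.comp continuous_fst)).prodMk continuous_snd)

/-- CONNECTEDNESS IS CLOSED: the configurations with connected intersection graph form a closed set — a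
finite union, over the connected edge patterns E ⊆ N × N, of finite intersections of the closed conditions
«segments i and j meet», (i,j) ∈ E. [cite: Balaban1987RG1, p.257 (linear size d_j, a shortest graph)] -/
theorem isClosed_setOf_graphConn (N : ℕ) : IsClosed {f : Config d N | GraphConn f} := by
  classical
  let 𝓔 : Finset (Finset (Fin N × Fin N)) :=
    Finset.univ.filter fun E => ∀ i j : Fin N, ReflTransGen (fun i j => (i, j) ∈ E) i j
  let M : Fin N × Fin N → Set (Config d N) := fun e =>
    {f | (segment ℝ (f e.1).1 (f e.1).2 ∩ segment ℝ (f e.2).1 (f e.2).2).Nonempty}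
  have hset : {f : Config d N | GraphConn f} = ⋃ E ∈ (𝓔 : Set (Finset (Fin N × Fin N))), ⋂ e ∈ E, M e := by
    ext f
    simp only [Set.mem_setOf_eq, Set.mem_iUnion, Set.mem_iInter, exists_prop]
    constructor
    · intro hf
      refine ⟨Finset.univ.filter fun e => f ∈ M e, ?_, fun e he => (Finset.mem_filter.1 he).2⟩
      refine Finset.mem_filter.2 ⟨Finset.mem_univ _, fun i j => ?_⟩
      refine reflTransGen_of_imp (fun a b hab => ?_) (hf i j)
      exact Finset.mem_filter.2 ⟨Finset.mem_univ _, hab⟩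
    · rintro ⟨E, hE, hfE⟩ i j
      have hE' := (Finset.mem_filter.1 hE).2 i j
      exact reflTransGen_of_imp (fun a b (hab : (a, b) ∈ E) => hfE (a, b) hab) hE'
  rw [hset]
  refine (Finset.finite_toSet 𝓔).isClosed_biUnion fun E _ => isClosed_biInter fun e _ => ?_
  exact isClosed_setOf_segments_meet e.1 e.2

/-- For N ≥ 1 segments: the graph is connected iff its intersection graph is connected (§3 and Mathlib's
`IsConnected.iUnion_of_reflTransGen`). [cite: Balaban1987RG1, p.257 (linear size d_j, a shortest graph)] -/
theorem isConnected_carrier_ofFn_iff {N : ℕ} (hN : 0 < N) (f : Config d N) :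
    IsConnected (carrier (List.ofFn f)) ↔ GraphConn f := by
  haveI : Nonempty (Fin N) := ⟨⟨0, hN⟩⟩
  rw [carrier_ofFn]
  constructor
  · intro h i j
    exact reflTransGen_of_isPreconnected_iUnion h.isPreconnected (fun i => isClosed_segment' (f i))
      (fun i => ⟨(f i).1, left_mem_segment ℝ _ _⟩) i j
  · intro h
    exact IsConnected.iUnion_of_reflTransGen
      (fun i => ⟨⟨(f i).1, left_mem_segment ℝ _ _⟩, (convex_segment _ _).isPreconnected⟩) h

/-- THE ADMISSIBLE CONFIGURATIONS FORM A CLOSED SET (N ≥ 1). [cite: Balaban1987RG1, p.257 (linear size d_j, a shortest graph)] -/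
theorem isClosed_setOf_admissible (X : Finset (Pt d)) {N : ℕ} (hN : 0 < N) :
    IsClosed {f : Config d N | Admissible X (List.ofFn f)} := by
  have hset : {f : Config d N | Admissible X (List.ofFn f)} =
      {f | GraphConn f} ∩ {f | carrier (List.ofFn f) ⊆ cubes X} ∩
        ⋂ x ∈ (X : Set (Pt d)), {f | (carrier (List.ofFn f) ∩ cube x).Nonempty} := by
    ext f
    simp only [Set.mem_setOf_eq, Set.mem_inter_iff, Set.mem_iInter, Finset.mem_coe]
    constructor
    · intro h
      exact ⟨⟨(isConnected_carrier_ofFn_iff hN f).1 h.connected, h.subset⟩, h.meets⟩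
    · rintro ⟨⟨h1, h2⟩, h3⟩
      exact ⟨(isConnected_carrier_ofFn_iff hN f).2 h1, h2, h3⟩
  rw [hset]
  refine ((isClosed_setOf_graphConn N).inter (isClosed_setOf_carrier_subset
    (show IsClosed (cubes X) from isClosed_biUnion_finset fun _ _ => isClosed_Icc))).inter ?_
  exact isClosed_biInter fun x _ => isClosed_setOf_carrier_meets isClosed_Icc

/-- THE ADMISSIBLE CONFIGURATIONS FORM A COMPACT SET (closed, and all endpoints lie in the compact union of the
cubes of X). [cite: Balaban1987RG1, p.257 (linear size d_j, a shortest graph)] -/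
theorem isCompact_setOf_admissible (X : Finset (Pt d)) {N : ℕ} (hN : 0 < N) :
    IsCompact {f : Config d N | Admissible X (List.ofFn f)} := by
  have hK : IsCompact (Set.pi Set.univ fun _ : Fin N => cubes X ×ˢ cubes X) :=
    isCompact_univ_pi fun _ => (isCompact_cubes X).prod (isCompact_cubes X)
  refine hK.of_isClosed_subset (isClosed_setOf_admissible X hN) fun f hf => ?_
  simp only [Set.mem_pi, Set.mem_univ, Set.mem_prod, forall_true_left]
  intro i
  have hs : segment ℝ (f i).1 (f i).2 ⊆ cubes X := by
    intro z hz
    exact hf.subset (mem_carrier_ofFn.2 ⟨i, hz⟩)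
  exact ⟨hs (left_mem_segment ℝ _ _), hs (right_mem_segment ℝ _ _)⟩

/-! ### Padding with degenerate segments: graphs with at most N segments vs exactly N segments -/

/-- The carrier of m copies of the degenerate segment [p, p] is contained in {p}. [cite: Balaban1987RG1, p.257 (linear size d_j, a shortest graph)] -/
theorem carrier_replicate_subset (p : RPt d) : ∀ m : ℕ, carrier (List.replicate m (p, p)) ⊆ {p}
  | 0 => by simp
  | m + 1 => by
      rw [List.replicate_succ, carrier_cons, segment_same]
      exact Set.union_subset (subset_refl _) (carrier_replicate_subset p m)

/-- m copies of the degenerate segment [p, p] have length 0. [cite: Balaban1987RG1, p.257 (linear size d_j, a shortest graph)] -/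
theorem len_replicate (p : RPt d) : ∀ m : ℕ, len (List.replicate m (p, p)) = 0
  | 0 => by simp
  | m + 1 => by rw [List.replicate_succ, len_cons, len_replicate p m, dist_self, add_zero]

/-- PADDING: appending degenerate segments at a point of the graph keeps it admissible, with the same length.
[cite: Balaban1987RG1, p.257 (linear size d_j, a shortest graph)] -/
theorem admissible_pad {X : Finset (Pt d)} {T : List (Seg d)} (hT : Admissible X T) {p : RPt d}
    (hp : p ∈ carrier T) (m : ℕ) :
    Admissible X (T ++ List.replicate m (p, p)) ∧ len (T ++ List.replicate m (p, p)) = len T := by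
  have hc : carrier (T ++ List.replicate m (p, p)) = carrier T := by
    rw [carrier_append]
    exact Set.union_eq_self_of_subset_right
      ((carrier_replicate_subset p m).trans (Set.singleton_subset_iff.2 hp))
  refine ⟨⟨?_, ?_, ?_⟩, ?_⟩
  · rw [hc]; exact hT.connected
  · rw [hc]; exact hT.subset
  · rw [hc]; exact hT.meets
  · rw [len_append, len_replicate, add_zero]

/-- An admissible graph with at most N segments can be padded to an admissible configuration of exactly N
segments with the same length. [cite: Balaban1987RG1, p.257 (linear size d_j, a shortest graph)] -/
theorem exists_config_of_admissible {X : Finset (Pt d)} {T : List (Seg d)} (hT : Admissible X T) {N : ℕ}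
    (hN : T.length ≤ N) : ∃ f : Config d N, Admissible X (List.ofFn f) ∧ len (List.ofFn f) = len T := by
  obtain ⟨p, hp⟩ := hT.connected.nonempty
  obtain ⟨hA, hlen⟩ := admissible_pad hT hp (N - T.length)
  have hLN : (T ++ List.replicate (N - T.length) (p, p)).length = N := by
    rw [List.length_append, List.length_replicate]
    omega
  let f : Config d N := fun i => (T ++ List.replicate (N - T.length) (p, p)).get (i.cast hLN.symm)
  have hf : List.ofFn f = T ++ List.replicate (N - T.length) (p, p) := by
    apply List.ext_getElem
    · rw [List.length_ofFn, hLN]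
    · intro k h1 h2
      rw [List.getElem_ofFn]
      simp [f]
  refine ⟨f, ?_, ?_⟩
  · rw [hf]; exact hA
  · rw [hf]; exact hlen

/-- PART D — MINIMUM OVER GRAPHS OF BOUNDED COMPLEXITY: among the admissible graphs with at most N segments (if
there are any) there is one of least length (compactness of the configuration space + closedness of
admissibility + continuity of the length). [cite: Balaban1987RG1, p.257 (linear size d_j, a shortest graph)] -/
theorem exists_min_admissible_length_le (X : Finset (Pt d)) (N : ℕ) (hne : ∃ T, Admissible X T ∧ T.length ≤ N) :
    ∃ T, Admissible X T ∧ T.length ≤ N ∧ ∀ T', Admissible X T' → T'.length ≤ N → len T ≤ len T' := by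
  obtain ⟨T₀, hT₀, hT₀N⟩ := hne
  have hN : 0 < N := by
    have h1 : T₀ ≠ [] := by
      intro h
      have := hT₀.connected.nonempty
      rw [h, carrier_nil] at this
      exact Set.not_nonempty_empty this
    have := List.length_pos_iff.2 h1
    omega
  obtain ⟨f₀, hf₀, -⟩ := exists_config_of_admissible hT₀ hT₀N
  obtain ⟨f, hf, hmin⟩ := (isCompact_setOf_admissible X hN).exists_isMinOn ⟨f₀, hf₀⟩
    (continuous_len_ofFn N).continuousOn
  refine ⟨List.ofFn f, hf, by simp, fun T' hT' hT'N => ?_⟩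
  obtain ⟨g, hg, hglen⟩ := exists_config_of_admissible hT' hT'N
  rw [← hglen]
  exact hmin hg

/-! ## §5. A Steiner sub-structure of a finite connected graph: kept vertices and vertex-disjoint chains -/

section Steiner

variable {α : Type*}

/-- A CHAIN of the Steiner structure: (first kept vertex, list of interior vertices, last kept vertex). [cite: Balaban1987RG1, p.257 (linear size d_j, a shortest graph)] -/
abbrev Chain (α : Type*) := α × List α × α

/-- The interior vertices COVERED by a list of chains. [cite: Balaban1987RG1, p.257 (linear size d_j, a shortest graph)] -/
def Covered (C : List (Chain α)) (w : α) : Prop := ∃ c ∈ C, w ∈ c.2.1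

/-- Two kept vertices are LINKED when some chain joins them (in either orientation). [cite: Balaban1987RG1, p.257 (linear size d_j, a shortest graph)] -/
def Link (C : List (Chain α)) (b b' : α) : Prop :=
  ∃ c ∈ C, (c.1 = b ∧ c.2.2 = b') ∨ (c.1 = b' ∧ c.2.2 = b)

/-- `Link` is symmetric. [cite: Balaban1987RG1, p.257 (linear size d_j, a shortest graph)] -/
theorem link_symm {C : List (Chain α)} {b b' : α} (h : Link C b b') : Link C b' b := by
  obtain ⟨c, hc, h⟩ := h
  exact ⟨c, hc, h.symm⟩

/-- Paths of links can be reversed (`Link` is symmetric). [cite: Balaban1987RG1, p.257 (linear size d_j, a shortest graph)] -/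
theorem link_rtg_symm {C : List (Chain α)} {x y : α} (h : ReflTransGen (Link C) x y) :
    ReflTransGen (Link C) y x := by
  induction h with
  | refl => exact ReflTransGen.refl
  | tail _ hbc ih => exact ReflTransGen.head (link_symm hbc) ih

/-- `Link` is monotone in the list of chains. [cite: Balaban1987RG1, p.257 (linear size d_j, a shortest graph)] -/
theorem link_mono {C C' : List (Chain α)} (hCC' : ∀ c ∈ C, c ∈ C') {b b' : α} (h : Link C b b') :
    Link C' b b' := by
  obtain ⟨c, hc, h⟩ := h
  exact ⟨c, hCC' c hc, h⟩

/-- A GOOD STEINER STRUCTURE on the vertex set S for the adjacency Q: kept vertices B ⊆ S and chains whose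
consecutive vertices are Q-adjacent, whose ends are kept, whose interiors are duplicate-free, pairwise disjoint,
inside S and outside B, and such that the chains connect all kept vertices. [cite: Balaban1987RG1, p.257 (linear size d_j, a shortest graph)] -/
structure Good (Q : α → α → Prop) (S B : Finset α) (C : List (Chain α)) : Prop where
  /-- kept vertices lie in S -/
  B_sub : B ⊆ S
  /-- the two ends of every chain are kept vertices -/
  ends : ∀ c ∈ C, c.1 ∈ B ∧ c.2.2 ∈ B
  /-- consecutive vertices of a chain are adjacent -/
  chain : ∀ c ∈ C, List.IsChain Q (c.1 :: (c.2.1 ++ [c.2.2]))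
  /-- interior vertices lie in S and are not kept -/
  int_sub : ∀ c ∈ C, ∀ w ∈ c.2.1, w ∈ S ∧ w ∉ B
  /-- the interior of a chain is duplicate-free -/
  int_nodup : ∀ c ∈ C, c.2.1.Nodup
  /-- interiors of different chains are disjoint -/
  int_disj : C.Pairwise fun c c' => ∀ w ∈ c.2.1, w ∉ c'.2.1
  /-- the chains connect the kept vertices -/
  conn : ∀ b ∈ B, ∀ b' ∈ B, ReflTransGen (Link C) b b'

/-- The trivial structure: one kept vertex, no chain. [cite: Balaban1987RG1, p.257 (linear size d_j, a shortest graph)] -/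
theorem good_singleton {Q : α → α → Prop} {S : Finset α} {t₀ : α} (h : t₀ ∈ S) :
    Good Q S {t₀} [] where
  B_sub := Finset.singleton_subset_iff.2 h
  ends := by simp
  chain := by simp
  int_sub := by simp
  int_nodup := by simp
  int_disj := List.Pairwise.nil
  conn := by
    intro b hb b' hb'
    rw [Finset.mem_singleton] at hb hb'
    subst hb; subst hb'
    exact ReflTransGen.refl

/-- SPLITTING a chain at one of its interior vertices v: v becomes a kept vertex and the chain becomes two
chains; the covered set does not grow. [cite: Balaban1987RG1, p.257 (linear size d_j, a shortest graph)] -/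
theorem Good.split [DecidableEq α] {Q : α → α → Prop} {S B : Finset α} {C : List (Chain α)} (hg : Good Q S B C)
    {c : Chain α} (hc : c ∈ C) {v : α} (hv : v ∈ c.2.1) :
    ∃ C' : List (Chain α), Good Q S (insert v B) C' ∧ C'.length = C.length + 1 ∧
      ∀ w, Covered C' w → Covered C w := by
  obtain ⟨C₁, C₂, rfl⟩ := List.append_of_mem hc
  obtain ⟨I₁, I₂, hI⟩ := List.append_of_mem hv
  obtain ⟨b, I, b'⟩ := c
  simp only at hI hv
  subst hI
  -- facts about the old structure
  have hdisj := hg.int_disj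
  rw [List.pairwise_append, List.pairwise_cons] at hdisj
  obtain ⟨hP1, ⟨hPc, hP2⟩, hP12⟩ := hdisj
  have hnd := hg.int_nodup _ hc
  simp only at hnd
  rw [List.nodup_append, List.nodup_cons] at hnd
  obtain ⟨hndI₁, ⟨hvI₂, hndI₂⟩, hI₁I₂⟩ := hnd
  have hvI₁ : v ∉ I₁ := fun h => hI₁I₂ v h v (by simp) rfl
  have hch := hg.chain _ hc
  simp only at hch
  have hends := hg.ends _ hc
  simp only at hends
  have hsubC : ∀ c' ∈ C₁ ++ C₂, c' ∈ C₁ ++ (b, I₁ ++ v :: I₂, b') :: C₂ := by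
    intro c' hc'
    rcases List.mem_append.1 hc' with h | h
    · exact List.mem_append_left _ h
    · exact List.mem_append_right _ (List.mem_cons_of_mem _ h)
  -- old chains are interior-disjoint from c
  have hold : ∀ c' ∈ C₁ ++ C₂, ∀ w ∈ c'.2.1, w ∉ I₁ ++ v :: I₂ := by
    intro c' hc' w hw hwI
    rcases List.mem_append.1 hc' with h | h
    · exact hP12 c' h _ (List.mem_cons_self) w hw hwI
    · exact hPc c' h w hwI hw
  refine ⟨(b, I₁, v) :: (v, I₂, b') :: (C₁ ++ C₂), ?_, ?_, ?_⟩
  · refine ⟨?_, ?_, ?_, ?_, ?_, ?_, ?_⟩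
    · -- B_sub
      refine Finset.insert_subset_iff.2 ⟨?_, hg.B_sub⟩
      exact (hg.int_sub _ hc v (by simp)).1
    · -- ends
      intro c' hc'
      simp only [List.mem_cons] at hc'
      rcases hc' with rfl | rfl | hc'
      · exact ⟨Finset.mem_insert_of_mem hends.1, Finset.mem_insert_self _ _⟩
      · exact ⟨Finset.mem_insert_self _ _, Finset.mem_insert_of_mem hends.2⟩
      · have := hg.ends c' (hsubC c' hc')
        exact ⟨Finset.mem_insert_of_mem this.1, Finset.mem_insert_of_mem this.2⟩
    · -- chain
      intro c' hc'
      simp only [List.mem_cons] at hc'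
      rcases hc' with rfl | rfl | hc'
      · have h1 : b :: (I₁ ++ v :: I₂ ++ [b']) = (b :: (I₁ ++ [v])) ++ (I₂ ++ [b']) := by simp
        rw [h1] at hch
        exact hch.left_of_append
      · have h1 : b :: (I₁ ++ v :: I₂ ++ [b']) = (b :: I₁) ++ (v :: (I₂ ++ [b'])) := by simp
        rw [h1] at hch
        exact hch.right_of_append
      · exact hg.chain c' (hsubC c' hc')
    · -- int_sub
      intro c' hc' w hw
      simp only [List.mem_cons] at hc'
      rcases hc' with rfl | rfl | hc'
      · have h := hg.int_sub _ hc w (by simp [hw])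
        refine ⟨h.1, ?_⟩
        rw [Finset.mem_insert, not_or]
        exact ⟨fun h' => hvI₁ (h' ▸ hw), h.2⟩
      · have h := hg.int_sub _ hc w (by simp [hw])
        refine ⟨h.1, ?_⟩
        rw [Finset.mem_insert, not_or]
        exact ⟨fun h' => hvI₂ (h' ▸ hw), h.2⟩
      · have h := hg.int_sub c' (hsubC c' hc') w hw
        refine ⟨h.1, ?_⟩
        rw [Finset.mem_insert, not_or]
        exact ⟨fun h' => hold c' hc' w hw (by simp [h']), h.2⟩
    · -- int_nodup
      intro c' hc'
      simp only [List.mem_cons] at hc'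
      rcases hc' with rfl | rfl | hc'
      · exact hndI₁
      · exact hndI₂
      · exact hg.int_nodup c' (hsubC c' hc')
    · -- int_disj
      rw [List.pairwise_cons, List.pairwise_cons]
      refine ⟨?_, ?_, ?_⟩
      · intro c' hc'
        simp only [List.mem_cons] at hc'
        rcases hc' with rfl | hc'
        · intro w hw hw2
          exact hI₁I₂ w hw w (List.mem_cons_of_mem _ hw2) rfl
        · intro w hw hw'
          exact hold c' hc' w hw' (List.mem_append_left _ hw)
      · intro c' hc' w hw hw'
        exact hold c' hc' w hw' (List.mem_append_right _ (List.mem_cons_of_mem _ hw))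
      · rw [List.pairwise_append]
        exact ⟨hP1, hP2, fun a ha a' ha' => hP12 a ha a' (List.mem_cons_of_mem _ ha')⟩
    · -- conn
      have hlink : ∀ x y, Link (C₁ ++ (b, I₁ ++ v :: I₂, b') :: C₂) x y →
          ReflTransGen (Link ((b, I₁, v) :: (v, I₂, b') :: (C₁ ++ C₂))) x y := by
        intro x y hxy
        obtain ⟨c', hc', h⟩ := hxy
        rcases List.mem_append.1 hc' with h1 | h1
        · exact ReflTransGen.single ⟨c', by simp [h1], h⟩
        · rcases List.mem_cons.1 h1 with rfl | h1
          · simp only at h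
            have hbv : Link ((b, I₁, v) :: (v, I₂, b') :: (C₁ ++ C₂)) b v := ⟨(b, I₁, v), by simp, by simp⟩
            have hvb' : Link ((b, I₁, v) :: (v, I₂, b') :: (C₁ ++ C₂)) v b' := ⟨(v, I₂, b'), by simp, by simp⟩
            rcases h with ⟨rfl, rfl⟩ | ⟨rfl, rfl⟩
            · exact (ReflTransGen.single hbv).tail hvb'
            · exact (ReflTransGen.single (link_symm hvb')).tail (link_symm hbv)
          · exact ReflTransGen.single ⟨c', by simp [h1], h⟩
      have hB : ∀ x ∈ B, ∀ y ∈ B, ReflTransGen (Link ((b, I₁, v) :: (v, I₂, b') :: (C₁ ++ C₂))) x y :=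
        fun x hx y hy => reflTransGen_of_imp_rtg hlink (hg.conn x hx y hy)
      have hvb : ReflTransGen (Link ((b, I₁, v) :: (v, I₂, b') :: (C₁ ++ C₂))) v b :=
        ReflTransGen.single ⟨(b, I₁, v), by simp, by simp⟩
      intro x hx y hy
      rw [Finset.mem_insert] at hx hy
      rcases hx with rfl | hx <;> rcases hy with rfl | hy
      · exact ReflTransGen.refl
      · exact hvb.trans (hB b hends.1 y hy)
      · exact link_rtg_symm (hvb.trans (hB b hends.1 x hx))
      · exact hB x hx y hy
  · simp only [List.length_cons, List.length_append]
    omega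
  · intro w hw
    obtain ⟨c', hc', hw⟩ := hw
    simp only [List.mem_cons] at hc'
    rcases hc' with rfl | rfl | hc'
    · exact ⟨_, hc, by simp only; exact List.mem_append_left _ hw⟩
    · exact ⟨_, hc, by simp only; exact List.mem_append_right _ (List.mem_cons_of_mem _ hw)⟩
    · exact ⟨c', hsubC c' hc', hw⟩

/-- ATTACHING a new kept vertex t by a fresh chain to a kept vertex v. [cite: Balaban1987RG1, p.257 (linear size d_j, a shortest graph)] -/
theorem Good.attach [DecidableEq α] {Q : α → α → Prop} {S B : Finset α} {C : List (Chain α)} (hg : Good Q S B C)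
    {v t : α} (hv : v ∈ B) (ht : t ∈ S) (htB : t ∉ B) (htC : ¬ Covered C t) {I : List α}
    (hI : List.IsChain Q (t :: (I ++ [v]))) (hnd : (t :: I).Nodup) (hIS : ∀ w ∈ I, w ∈ S)
    (hIB : ∀ w ∈ I, w ∉ B) (hIC : ∀ w ∈ I, ¬ Covered C w) :
    Good Q S (insert t B) ((t, I, v) :: C) := by
  rw [List.nodup_cons] at hnd
  refine ⟨Finset.insert_subset_iff.2 ⟨ht, hg.B_sub⟩, ?_, ?_, ?_, ?_, ?_, ?_⟩
  · intro c hc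
    rcases List.mem_cons.1 hc with rfl | hc
    · exact ⟨Finset.mem_insert_self _ _, Finset.mem_insert_of_mem hv⟩
    · exact ⟨Finset.mem_insert_of_mem (hg.ends c hc).1, Finset.mem_insert_of_mem (hg.ends c hc).2⟩
  · intro c hc
    rcases List.mem_cons.1 hc with rfl | hc
    · exact hI
    · exact hg.chain c hc
  · intro c hc w hw
    rcases List.mem_cons.1 hc with rfl | hc
    · refine ⟨hIS w hw, ?_⟩
      rw [Finset.mem_insert, not_or]
      exact ⟨fun h => hnd.1 (h ▸ hw), hIB w hw⟩
    · refine ⟨(hg.int_sub c hc w hw).1, ?_⟩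
      rw [Finset.mem_insert, not_or]
      exact ⟨fun h => htC ⟨c, hc, h ▸ hw⟩, (hg.int_sub c hc w hw).2⟩
  · intro c hc
    rcases List.mem_cons.1 hc with rfl | hc
    · exact hnd.2
    · exact hg.int_nodup c hc
  · rw [List.pairwise_cons]
    exact ⟨fun c hc w hw hw' => hIC w hw ⟨c, hc, hw'⟩, hg.int_disj⟩
  · have hB : ∀ x ∈ B, ∀ y ∈ B, ReflTransGen (Link ((t, I, v) :: C)) x y :=
      fun x hx y hy => reflTransGen_of_imp (fun a a' h => link_mono (fun c hc => List.mem_cons_of_mem _ hc) h)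
        (hg.conn x hx y hy)
    have htv : Link ((t, I, v) :: C) t v := ⟨(t, I, v), by simp, by simp⟩
    intro x hx y hy
    rw [Finset.mem_insert] at hx hy
    rcases hx with rfl | hx <;> rcases hy with rfl | hy
    · exact ReflTransGen.refl
    · exact (ReflTransGen.single htv).trans (hB v hv y hy)
    · exact (hB x hx v hv).tail (link_symm htv)
    · exact hB x hx y hy

/-- FIRST HIT: a chain from a vertex outside a set P of vertices to a vertex inside it has an initial piece
ending at its first vertex in P. [folklore] -/
private theorem exists_isChain_to_first {Q : α → α → Prop} (P : α → Prop) : ∀ (l : List α) (a : α),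
    List.IsChain Q (a :: l) → ¬ P a → P ((a :: l).getLast (List.cons_ne_nil _ _)) →
    ∃ (m : List α) (v : α), List.IsChain Q (a :: (m ++ [v])) ∧ P v ∧ (∀ w ∈ m, ¬ P w) ∧
      (∀ w ∈ m, w ∈ l) ∧ v ∈ l
  | [], a, _, ha, hl => absurd (by simpa using hl) ha
  | u :: l, a, hch, ha, hl => by
      rw [List.isChain_cons_cons] at hch
      by_cases hu : P u
      · exact ⟨[], u, by simpa using hch.1, hu, by simp, by simp, by simp⟩
      · have hl' : P ((u :: l).getLast (List.cons_ne_nil _ _)) := by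
          rwa [List.getLast_cons_cons] at hl
        obtain ⟨m, v, hmv, hPv, hm, hml, hvl⟩ := exists_isChain_to_first P l u hch.2 hu hl'
        refine ⟨u :: m, v, ?_, hPv, ?_, ?_, List.mem_cons_of_mem _ hvl⟩
        · rw [List.cons_append]
          exact List.IsChain.cons_cons hch.1 hmv
        · intro w hw
          rcases List.mem_cons.1 hw with rfl | hw
          · exact hu
          · exact hm w hw
        · intro w hw
          rcases List.mem_cons.1 hw with rfl | hw
          · exact List.mem_cons_self
          · exact List.mem_cons_of_mem _ (hml w hw)

/-- LOOP REMOVAL: a chain from a to b can be pruned to one whose vertices before b are pairwise distinct.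
[folklore] -/
private theorem exists_isChain_nodup {Q : α → α → Prop} : ∀ (n : ℕ) (a : α) (l : List α) (b : α),
    l.length ≤ n → List.IsChain Q (a :: (l ++ [b])) →
    ∃ l' : List α, (∀ w ∈ l', w ∈ l) ∧ List.IsChain Q (a :: (l' ++ [b])) ∧ (a :: l').Nodup := by
  intro n
  induction n with
  | zero =>
      intro a l b hl h
      have : l = [] := List.eq_nil_of_length_eq_zero (Nat.le_zero.1 hl)
      subst this
      exact ⟨[], by simp, h, List.nodup_singleton a⟩
  | succ n ih =>
      intro a l b hl h
      by_cases ha : a ∈ l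
      · obtain ⟨l₁, l₂, rfl⟩ := List.append_of_mem ha
        have h2 : List.IsChain Q (a :: (l₂ ++ [b])) := by
          have h1 : a :: (l₁ ++ a :: l₂ ++ [b]) = (a :: l₁) ++ (a :: (l₂ ++ [b])) := by simp
          rw [h1] at h
          exact h.right_of_append
        have hlen : l₂.length ≤ n := by
          rw [List.length_append, List.length_cons] at hl
          omega
        obtain ⟨l', hl', hch, hnd⟩ := ih a l₂ b hlen h2
        exact ⟨l', fun w hw => List.mem_append_right _ (List.mem_cons_of_mem _ (hl' w hw)), hch, hnd⟩
      · by_cases hnd : l.Nodup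
        · exact ⟨l, fun w hw => hw, h, List.nodup_cons.2 ⟨ha, hnd⟩⟩
        · have hl0 : l ≠ [] := by
            rintro rfl
            exact hnd List.nodup_nil
          obtain ⟨u, l'', rfl⟩ := List.exists_cons_of_ne_nil hl0
          rw [List.cons_append, List.isChain_cons_cons] at h
          have hlen : l''.length ≤ n := by
            rw [List.length_cons] at hl
            omega
          obtain ⟨l₃, hl₃, hch, hnd₃⟩ := ih u l'' b hlen h.2
          refine ⟨u :: l₃, ?_, ?_, ?_⟩
          · intro w hw
            rcases List.mem_cons.1 hw with rfl | hw
            · exact List.mem_cons_self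
            · exact List.mem_cons_of_mem _ (hl₃ w hw)
          · rw [List.cons_append]
            exact List.IsChain.cons_cons h.1 hch
          · rw [List.nodup_cons]
            refine ⟨fun h' => ha ?_, hnd₃⟩
            rcases List.mem_cons.1 h' with rfl | h'
            · exact List.mem_cons_self
            · exact List.mem_cons_of_mem _ (hl₃ _ h')

/-- All vertices of a Q-chain after its head lie in S when Q-steps end in S. [folklore] -/
private theorem mem_of_isChain {Q : α → α → Prop} {S : Finset α} (hQS : ∀ a b, Q a b → b ∈ S) :
    ∀ (l : List α) (a : α), List.IsChain Q (a :: l) → ∀ w ∈ l, w ∈ S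
  | [], _, _ => by simp
  | u :: l, a, h => by
      rw [List.isChain_cons_cons] at h
      intro w hw
      rcases List.mem_cons.1 hw with rfl | hw
      · exact hQS a _ h.1
      · exact mem_of_isChain hQS l u h.2 w hw

/-- THE PRIM STEP: a vertex t ∈ S outside B is made a kept vertex at the cost of at most two more kept vertices
and two more chains (split the chain through t; or walk from t to the structure along a loop-free chain of
fresh vertices, splitting the chain first hit if the walk ends at an interior vertex). [cite: Balaban1987RG1, p.257 (linear size d_j, a shortest graph)] -/
theorem Good.step [DecidableEq α] {Q : α → α → Prop} {S B : Finset α} {C : List (Chain α)}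
    (hconn : ∀ a ∈ S, ∀ b ∈ S, ReflTransGen Q a b) (hQS : ∀ a b, Q a b → b ∈ S)
    (hg : Good Q S B C) (hB : B.Nonempty) {t : α} (ht : t ∈ S) (htB : t ∉ B) :
    ∃ (B' : Finset α) (C' : List (Chain α)), Good Q S B' C' ∧ t ∈ B' ∧ B ⊆ B' ∧
      B'.card ≤ B.card + 2 ∧ C'.length ≤ C.length + 2 := by
  by_cases hcov : Covered C t
  · obtain ⟨c, hc, htc⟩ := hcov
    obtain ⟨C', hg', hlen, -⟩ := hg.split hc htc
    refine ⟨insert t B, C', hg', Finset.mem_insert_self _ _, Finset.subset_insert _ _, ?_, by omega⟩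
    exact (Finset.card_insert_le _ _).trans (by omega)
  · obtain ⟨b₀, hb₀⟩ := hB
    obtain ⟨l, hl, hlast⟩ := List.exists_isChain_cons_of_relationReflTransGen (hconn t ht b₀ (hg.B_sub hb₀))
    let P : α → Prop := fun w => w ∈ B ∨ Covered C w
    have hPt : ¬ P t := by
      rintro (h | h)
      · exact htB h
      · exact hcov h
    have hPlast : P ((t :: l).getLast (List.cons_ne_nil _ _)) := Or.inl (hlast ▸ hb₀)
    obtain ⟨m, v, hmv, hPv, hPm, -, -⟩ := exists_isChain_to_first P l t hl hPt hPlast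
    obtain ⟨m', hm'm, hch, hnd⟩ := exists_isChain_nodup m.length t m v le_rfl hmv
    have hm'S : ∀ w ∈ m', w ∈ S := fun w hw =>
      mem_of_isChain hQS (m' ++ [v]) t hch w (List.mem_append_left _ hw)
    have hm'B : ∀ w ∈ m', w ∉ B := fun w hw h => hPm w (hm'm w hw) (Or.inl h)
    have hm'C : ∀ w ∈ m', ¬ Covered C w := fun w hw h => hPm w (hm'm w hw) (Or.inr h)
    rcases hPv with hvB | hvC
    · -- the walk ends at a kept vertex
      refine ⟨insert t B, (t, m', v) :: C, hg.attach hvB ht htB hcov hch hnd hm'S hm'B hm'C,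
        Finset.mem_insert_self _ _, Finset.subset_insert _ _, ?_, by simp⟩
      exact (Finset.card_insert_le _ _).trans (by omega)
    · -- the walk ends at an interior vertex of a chain: split there first
      obtain ⟨c, hc, hvc⟩ := hvC
      obtain ⟨C'', hg'', hlen'', hcov''⟩ := hg.split hc hvc
      have htv : t ≠ v := by
        rintro rfl
        exact hcov ⟨c, hc, hvc⟩
      have htB' : t ∉ insert v B := by
        rw [Finset.mem_insert, not_or]
        exact ⟨htv, htB⟩
      have htC'' : ¬ Covered C'' t := fun h => hcov (hcov'' t h)
      have hm'B' : ∀ w ∈ m', w ∉ insert v B := by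
        intro w hw h
        rw [Finset.mem_insert] at h
        rcases h with rfl | h
        · exact hm'C w hw ⟨c, hc, hvc⟩
        · exact hm'B w hw h
      have hm'C'' : ∀ w ∈ m', ¬ Covered C'' w := fun w hw h => hm'C w hw (hcov'' w h)
      refine ⟨insert t (insert v B), (t, m', v) :: C'',
        hg''.attach (Finset.mem_insert_self _ _) ht htB' htC'' hch hnd hm'S hm'B' hm'C'',
        Finset.mem_insert_self _ _, ?_, ?_, ?_⟩
      · exact (Finset.subset_insert _ _).trans (Finset.subset_insert _ _)
      · exact (Finset.card_insert_le _ _).trans ((Nat.succ_le_succ (Finset.card_insert_le _ _)).trans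
          (by omega))
      · simp only [List.length_cons, hlen'']
        omega

/-- ITERATING the Prim step over a list of terminal vertices. [cite: Balaban1987RG1, p.257 (linear size d_j, a shortest graph)] -/
theorem Good.iter [DecidableEq α] {Q : α → α → Prop} {S : Finset α}
    (hconn : ∀ a ∈ S, ∀ b ∈ S, ReflTransGen Q a b) (hQS : ∀ a b, Q a b → b ∈ S) :
    ∀ (ts : List α), (∀ t ∈ ts, t ∈ S) → ∀ (B : Finset α) (C : List (Chain α)), Good Q S B C → B.Nonempty →
      ∃ (B' : Finset α) (C' : List (Chain α)), Good Q S B' C' ∧ (∀ t ∈ ts, t ∈ B') ∧ B ⊆ B' ∧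
        B'.card ≤ B.card + 2 * ts.length ∧ C'.length ≤ C.length + 2 * ts.length
  | [], _, B, C, hg, _ => ⟨B, C, hg, by simp, subset_refl _, by simp, by simp⟩
  | t :: ts, hts, B, C, hg, hB => by
      have hts' : ∀ t' ∈ ts, t' ∈ S := fun t' h => hts t' (List.mem_cons_of_mem _ h)
      by_cases htB : t ∈ B
      · obtain ⟨B', C', hg', hmem, hsub, hcard, hlen⟩ := Good.iter hconn hQS ts hts' B C hg hB
        refine ⟨B', C', hg', ?_, hsub, ?_, ?_⟩
        · intro t' ht'
          rcases List.mem_cons.1 ht' with rfl | ht'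
          · exact hsub htB
          · exact hmem t' ht'
        · simp only [List.length_cons]; omega
        · simp only [List.length_cons]; omega
      · obtain ⟨B₁, C₁, hg₁, ht₁, hsub₁, hcard₁, hlen₁⟩ :=
          hg.step hconn hQS hB (hts t List.mem_cons_self) htB
        obtain ⟨B', C', hg', hmem, hsub, hcard, hlen⟩ :=
          Good.iter hconn hQS ts hts' B₁ C₁ hg₁ ⟨t, ht₁⟩
        refine ⟨B', C', hg', ?_, hsub₁.trans hsub, ?_, ?_⟩
        · intro t' ht'
          rcases List.mem_cons.1 ht' with rfl | ht'
          · exact hsub ht₁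
          · exact hmem t' ht'
        · simp only [List.length_cons]; omega
        · simp only [List.length_cons]; omega

/-- PART B — THE STEINER SUB-STRUCTURE: in a finite Q-connected vertex set S, every non-empty list of n
terminal vertices is contained in the kept set of a good Steiner structure with at most 2n + 1 kept vertices
and at most 2n chains. [cite: Balaban1987RG1, p.257 (linear size d_j, a shortest graph)] -/
theorem exists_good [DecidableEq α] {Q : α → α → Prop} {S : Finset α}
    (hconn : ∀ a ∈ S, ∀ b ∈ S, ReflTransGen Q a b) (hQS : ∀ a b, Q a b → b ∈ S)
    (ts : List α) (hts : ∀ t ∈ ts, t ∈ S) {t₀ : α} (ht₀ : t₀ ∈ ts) :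
    ∃ (B : Finset α) (C : List (Chain α)), Good Q S B C ∧ (∀ t ∈ ts, t ∈ B) ∧
      B.card ≤ 2 * ts.length + 1 ∧ C.length ≤ 2 * ts.length := by
  obtain ⟨B, C, hg, hmem, -, hcard, hlen⟩ :=
    Good.iter hconn hQS ts hts {t₀} [] (good_singleton (hts t₀ ht₀)) ⟨t₀, Finset.mem_singleton_self _⟩
  refine ⟨B, C, hg, hmem, ?_, ?_⟩
  · rw [Finset.card_singleton] at hcard; omega
  · simpa using hlen

end Steiner

/-! ## §6. Realisation: every admissible graph is dominated by one with at most `segBound |X|` segments -/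

/-- Two points of a segment are at distance at most the length of the segment. [cite: Balaban1987RG1, p.257 (linear size d_j, a shortest graph)] -/
theorem dist_le_of_mem_segment {s : Seg d} {p q : RPt d} (hp : p ∈ segment ℝ s.1 s.2)
    (hq : q ∈ segment ℝ s.1 s.2) : dist p q ≤ dist s.1 s.2 := by
  rw [segment_eq_image_gam] at hp hq
  obtain ⟨t, ht, rfl⟩ := hp
  obtain ⟨u, hu, rfl⟩ := hq
  have h1 : gam s t - gam s u = (t - u) • (s.2 - s.1) := by
    simp only [gam]
    rw [sub_smul]
    abel
  rw [dist_eq_norm, h1, norm_smul, dist_comm, dist_eq_norm]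
  have h2 : ‖t - u‖ ≤ 1 := by
    rw [Real.norm_eq_abs, abs_le]
    constructor <;> linarith [ht.1, ht.2, hu.1, hu.2]
  calc ‖t - u‖ * ‖s.2 - s.1‖ ≤ 1 * ‖s.2 - s.1‖ := by gcongr
    _ = ‖s.2 - s.1‖ := one_mul _

/-- THREADING points through a chain of segments: `Thread [w₀, …, w_r] [p₀, …, p_{r−1}]` says that p_i lies on
both w_i and w_{i+1}. [cite: Balaban1987RG1, p.257 (linear size d_j, a shortest graph)] -/
def Thread : List (Seg d) → List (RPt d) → Prop
  | a :: b :: L, p :: P => p ∈ segment ℝ a.1 a.2 ∧ p ∈ segment ℝ b.1 b.2 ∧ Thread (b :: L) P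
  | _ :: _ :: _, [] => False
  | [_], P => P = []
  | [], P => P = []

/-- Unfolding `Thread` on a chain with at least two segments. [cite: Balaban1987RG1, p.257 (linear size d_j, a shortest graph)] -/
theorem thread_cons_cons {a b : Seg d} {L : List (Seg d)} {P : List (RPt d)} (h : Thread (a :: b :: L) P) :
    ∃ p P', P = p :: P' ∧ p ∈ segment ℝ a.1 a.2 ∧ p ∈ segment ℝ b.1 b.2 ∧ Thread (b :: L) P' := by
  cases P with
  | nil => exact h.elim
  | cons p P' => exact ⟨p, P', rfl, h.1, h.2.1, h.2.2⟩

/-- A chain of consecutively intersecting segments can be threaded. [cite: Balaban1987RG1, p.257 (linear size d_j, a shortest graph)] -/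
theorem exists_thread {Q : Seg d → Seg d → Prop}
    (hQ : ∀ a b, Q a b → (segment ℝ a.1 a.2 ∩ segment ℝ b.1 b.2).Nonempty) :
    ∀ (L : List (Seg d)), List.IsChain Q L → ∃ P, Thread L P
  | [], _ => ⟨[], rfl⟩
  | [_], _ => ⟨[], rfl⟩
  | a :: b :: L, h => by
      rw [List.isChain_cons_cons] at h
      obtain ⟨p, hpa, hpb⟩ := hQ a b h.1
      obtain ⟨P, hP⟩ := exists_thread hQ (b :: L) h.2
      exact ⟨p :: P, hpa, hpb, hP⟩

/-- The first threaded point lies on the first two segments. [cite: Balaban1987RG1, p.257 (linear size d_j, a shortest graph)] -/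
theorem thread_head {a b : Seg d} {L : List (Seg d)} {P : List (RPt d)} (h : Thread (a :: b :: L) P) :
    ∃ hP : P ≠ [], P.head hP ∈ segment ℝ a.1 a.2 ∧ P.head hP ∈ segment ℝ b.1 b.2 := by
  obtain ⟨p, P', rfl, hpa, hpb, -⟩ := thread_cons_cons h
  exact ⟨List.cons_ne_nil _ _, hpa, hpb⟩

/-- The last threaded point lies on the last segment. [cite: Balaban1987RG1, p.257 (linear size d_j, a shortest graph)] -/
theorem thread_getLast : ∀ (L : List (Seg d)) (a : Seg d) (P : List (RPt d)), Thread (a :: L) P →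
    ∀ hL : L ≠ [], ∃ hP : P ≠ [], P.getLast hP ∈ segment ℝ (L.getLast hL).1 (L.getLast hL).2
  | [], _, _, _, hL => (hL rfl).elim
  | [b], a, P, h, _ => by
      obtain ⟨p, P', rfl, -, hpb, hP'⟩ := thread_cons_cons h
      have : P' = [] := hP'
      subst this
      exact ⟨List.cons_ne_nil _ _, by simpa using hpb⟩
  | b :: c :: L, a, P, h, _ => by
      obtain ⟨p, P', rfl, -, -, hP'⟩ := thread_cons_cons h
      obtain ⟨hP'ne, hlast⟩ := thread_getLast (c :: L) b P' hP' (List.cons_ne_nil _ _)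
      refine ⟨List.cons_ne_nil _ _, ?_⟩
      rw [List.getLast_cons hP'ne, List.getLast_cons_cons]
      exact hlast

/-- Every threaded point lies on some segment of the chain. [cite: Balaban1987RG1, p.257 (linear size d_j, a shortest graph)] -/
theorem thread_mem : ∀ (L : List (Seg d)) (a : Seg d) (P : List (RPt d)), Thread (a :: L) P →
    ∀ p ∈ P, ∃ w ∈ a :: L, p ∈ segment ℝ w.1 w.2
  | [], a, P, h => by
      have : P = [] := h
      subst this
      simp
  | b :: L, a, P, h => by
      obtain ⟨p, P', rfl, hpa, -, hP'⟩ := thread_cons_cons h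
      intro q hq
      rcases List.mem_cons.1 hq with rfl | hq
      · exact ⟨a, List.mem_cons_self, hpa⟩
      · obtain ⟨w, hw, hqw⟩ := thread_mem L b P' hP' q hq
        exact ⟨w, List.mem_cons_of_mem _ hw, hqw⟩

/-- Consecutive threaded points of the chain `b :: (I ++ [b'])` lie on a common INTERIOR segment w ∈ I.
[cite: Balaban1987RG1, p.257 (linear size d_j, a shortest graph)] -/
theorem thread_pathSegs : ∀ (I : List (Seg d)) (b b' : Seg d) (P : List (RPt d)), Thread (b :: (I ++ [b'])) P →
    ∀ s ∈ pathSegs P, ∃ w ∈ I, s.1 ∈ segment ℝ w.1 w.2 ∧ s.2 ∈ segment ℝ w.1 w.2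
  | [], b, b', P, h => by
      obtain ⟨p, P', rfl, -, -, hP'⟩ := thread_cons_cons h
      have : P' = [] := hP'
      subst this
      simp
  | w :: I, b, b', P, h => by
      rw [List.cons_append] at h
      obtain ⟨p, P', rfl, -, hpw, hP'⟩ := thread_cons_cons h
      have hne : I ++ [b'] ≠ [] := by simp
      obtain ⟨c, L, hcL⟩ := List.exists_cons_of_ne_nil hne
      rw [hcL] at hP'
      obtain ⟨hP'ne, hhead, -⟩ := thread_head hP'
      rw [← hcL] at hP'
      intro s hs
      rw [pathSegs_cons_of_ne_nil p hP'ne] at hs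
      rcases List.mem_cons.1 hs with rfl | hs
      · exact ⟨w, List.mem_cons_self, hpw, hhead⟩
      · obtain ⟨w', hw', hs'⟩ := thread_pathSegs I w b' P' hP' s hs
        exact ⟨w', List.mem_cons_of_mem _ hw', hs'⟩

/-- The threaded path of `b :: (I ++ [b'])` is not longer than the total length of the interior segments I
(each of its segments lies inside one interior segment, used once). [cite: Balaban1987RG1, p.257 (linear size d_j, a shortest graph)] -/
theorem thread_len : ∀ (I : List (Seg d)) (b b' : Seg d) (P : List (RPt d)), Thread (b :: (I ++ [b'])) P →
    len (pathSegs P) ≤ len I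
  | [], b, b', P, h => by
      obtain ⟨p, P', rfl, -, -, hP'⟩ := thread_cons_cons h
      have : P' = [] := hP'
      subst this
      simp
  | w :: I, b, b', P, h => by
      rw [List.cons_append] at h
      obtain ⟨p, P', rfl, -, hpw, hP'⟩ := thread_cons_cons h
      have hne : I ++ [b'] ≠ [] := by simp
      obtain ⟨c, L, hcL⟩ := List.exists_cons_of_ne_nil hne
      rw [hcL] at hP'
      obtain ⟨hP'ne, hhead, -⟩ := thread_head hP'
      rw [← hcL] at hP'
      have ih := thread_len I w b' P' hP'
      rw [pathSegs_cons_of_ne_nil p hP'ne, len_cons, len_cons]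
      have := dist_le_of_mem_segment hpw hhead
      simp only at this ⊢
      linarith

/-- A PIECE realising a chain (b, I, b'): a short connected polygonal graph inside the cubes of X joining the
segment b to the segment b', not longer than the interior I. [cite: Balaban1987RG1, p.257 (linear size d_j, a shortest graph)] -/
structure Piece (X : Finset (Pt d)) (c : Chain (Seg d)) (g : List (Seg d)) : Prop where
  /-- inside X -/
  subset : ∀ s ∈ g, segment ℝ s.1 s.2 ⊆ cubes X
  /-- connected -/
  connected : IsConnected (carrier g)
  /-- meets the first end segment -/
  meets_fst : (carrier g ∩ segment ℝ c.1.1 c.1.2).Nonempty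
  /-- meets the last end segment -/
  meets_lst : (carrier g ∩ segment ℝ c.2.2.1 c.2.2.2).Nonempty
  /-- not longer than the interior -/
  len_le : len g ≤ len c.2.1
  /-- short -/
  length_le : g.length ≤ 2 * X.card

/-- The adjacency used for the intersection graph of the segments of T: the segments meet, and the second one is a
segment of T. [cite: Balaban1987RG1, p.257 (linear size d_j, a shortest graph)] -/
def SegAdj (S : Finset (Seg d)) (a b : Seg d) : Prop :=
  (segment ℝ a.1 a.2 ∩ segment ℝ b.1 b.2).Nonempty ∧ b ∈ S

/-- EXISTENCE OF PIECES: a `SegAdj`-chain b, I, b' of segments lying in the cubes of X is realised by a piece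
(thread points through the chain, §1/§2 shortcut the threaded path to ≤ 2|X| vertices, and add the degenerate
segment at its first vertex so that the piece is never empty). [cite: Balaban1987RG1, p.257 (linear size d_j, a shortest graph)] -/
theorem exists_piece (X : Finset (Pt d)) {S : Finset (Seg d)} (hS : ∀ s ∈ S, segment ℝ s.1 s.2 ⊆ cubes X)
    (c : Chain (Seg d)) (hb : c.1 ∈ S) (hch : List.IsChain (SegAdj S) (c.1 :: (c.2.1 ++ [c.2.2]))) :
    ∃ g, Piece X c g := by
  obtain ⟨b, I, b'⟩ := c
  simp only at hb hch ⊢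
  have hmemS : ∀ w ∈ I ++ [b'], w ∈ S := mem_of_isChain (fun _ _ h => h.2) _ b hch
  obtain ⟨P, hP⟩ := exists_thread (fun _ _ h => h.1) _ hch
  have hne : I ++ [b'] ≠ [] := by simp
  -- endpoints of the threaded path
  obtain ⟨w₁, L₁, hwL⟩ := List.exists_cons_of_ne_nil hne
  have hP2 := hP
  rw [hwL] at hP2
  obtain ⟨hPne, hheadb, -⟩ := thread_head hP2
  obtain ⟨hPne', hlast⟩ := thread_getLast (I ++ [b']) b P hP hne
  rw [List.getLast_append_of_ne_nil _ (List.cons_ne_nil _ _)] at hlast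
  simp only [List.getLast_singleton] at hlast
  -- the threaded path lies in the cubes of X
  have hsegs : ∀ s ∈ pathSegs P, segment ℝ s.1 s.2 ⊆ cubes X := by
    intro s hs
    obtain ⟨w, hw, h1, h2⟩ := thread_pathSegs I b b' P hP s hs
    exact ((convex_segment _ _).segment_subset h1 h2).trans (hS w (hmemS w (List.mem_append_left _ hw)))
  have hverts : ∀ p ∈ P, p ∈ cubes X := by
    intro p hp
    obtain ⟨w, hw, hpw⟩ := thread_mem (I ++ [b']) b P hP p hp
    rcases List.mem_cons.1 hw with rfl | hw
    · exact hS _ hb hpw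
    · exact hS w (hmemS w hw) hpw
  obtain ⟨P', hP'ne, hhead', hlast', hsegs', hlen', hlength'⟩ := exists_short_path X P hPne hsegs hverts
  refine ⟨(P'.head hP'ne, P'.head hP'ne) :: pathSegs P', ?_, ?_, ?_, ?_, ?_, ?_⟩
  · intro s hs
    rcases List.mem_cons.1 hs with rfl | hs
    · simp only [segment_same, Set.singleton_subset_iff]
      rw [hhead']
      exact hverts _ (List.head_mem hPne)
    · exact hsegs' s hs
  · rw [carrier_cons, segment_same, Set.singleton_union]
    exact (isConnected_insert_carrier_pathSegs P' hP'ne).1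
  · refine ⟨P'.head hP'ne, ?_, by rw [hhead']; exact hheadb⟩
    rw [carrier_cons, segment_same]
    exact Or.inl rfl
  · refine ⟨P'.getLast hP'ne, ?_, by rw [hlast']; exact hlast⟩
    rw [carrier_cons, segment_same, Set.singleton_union]
    exact (isConnected_insert_carrier_pathSegs P' hP'ne).2 _ (List.getLast_mem hP'ne)
  · rw [len_cons, dist_self, zero_add]
    exact hlen'.trans (thread_len I b b' P hP)
  · rw [List.length_cons, length_pathSegs]
    have := List.length_pos_iff.2 hP'ne
    omega

/-- Pieces for all chains of a list. [cite: Balaban1987RG1, p.257 (linear size d_j, a shortest graph)] -/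
theorem exists_pieces (X : Finset (Pt d)) {S : Finset (Seg d)} (hS : ∀ s ∈ S, segment ℝ s.1 s.2 ⊆ cubes X) :
    ∀ (C : List (Chain (Seg d))), (∀ c ∈ C, c.1 ∈ S ∧ List.IsChain (SegAdj S) (c.1 :: (c.2.1 ++ [c.2.2]))) →
      ∃ GP : List (Chain (Seg d) × List (Seg d)), GP.map Prod.fst = C ∧ ∀ p ∈ GP, Piece X p.1 p.2
  | [], _ => ⟨[], rfl, by simp⟩
  | c :: C, h => by
      obtain ⟨g, hg⟩ := exists_piece X hS c (h c List.mem_cons_self).1 (h c List.mem_cons_self).2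
      obtain ⟨GP, hGP, hP⟩ := exists_pieces X hS C fun c' hc' => h c' (List.mem_cons_of_mem _ hc')
      refine ⟨(c, g) :: GP, by simp [hGP], ?_⟩
      intro p hp
      rcases List.mem_cons.1 hp with rfl | hp
      · exact hg
      · exact hP p hp

/-- Carrier of a concatenation of graphs. [cite: Balaban1987RG1, p.257 (linear size d_j, a shortest graph)] -/
theorem mem_carrier_flatten {G : List (List (Seg d))} {z : RPt d} :
    z ∈ carrier G.flatten ↔ ∃ g ∈ G, z ∈ carrier g := by
  induction G with
  | nil => simp
  | cons g G ih => simp [List.flatten_cons, carrier_append, ih]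

/-- Length of a concatenation of graphs. [cite: Balaban1987RG1, p.257 (linear size d_j, a shortest graph)] -/
theorem len_flatten : ∀ (G : List (List (Seg d))), len G.flatten = (G.map len).sum
  | [] => by simp
  | g :: G => by rw [List.flatten_cons, len_append, len_flatten G, List.map_cons, List.sum_cons]

/-- The segment bound: an admissible graph can always be shortened to at most `segBound |X|` segments
(2|X| + 1 kept segments and 2|X| pieces of at most 2|X| segments each). [cite: Balaban1987RG1, p.257 (linear size d_j, a shortest graph)] -/
def segBound (n : ℕ) : ℕ := 4 * n ^ 2 + 2 * n + 1

/-- For a non-negative function, the sum over the distinct members of a list is at most the sum over the list.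
[folklore] -/
private theorem sum_toFinset_le_sum_map {β : Type*} [DecidableEq β] (f : β → ℝ) (hf : ∀ x, 0 ≤ f x) :
    ∀ (l : List β), ∑ x ∈ l.toFinset, f x ≤ (l.map f).sum
  | [] => by simp
  | a :: l => by
      rw [List.toFinset_cons, List.map_cons, List.sum_cons]
      by_cases ha : a ∈ l.toFinset
      · rw [Finset.insert_eq_of_mem ha]
        have := sum_toFinset_le_sum_map f hf l
        linarith [hf a]
      · rw [Finset.sum_insert ha]
        have := sum_toFinset_le_sum_map f hf l
        linarith

/-- ACCOUNTING: kept segments and chain interiors are distinct segments of T, so their total length is at most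
the length of T. [cite: Balaban1987RG1, p.257 (linear size d_j, a shortest graph)] -/
theorem sum_kept_add_sum_interiors_le {S B : Finset (Seg d)} {C : List (Chain (Seg d))} {Q : Seg d → Seg d → Prop}
    (hg : Good Q S B C) {T : List (Seg d)} (hST : S = T.toFinset) :
    (∑ b ∈ B, dist b.1 b.2) + (C.map fun c => len c.2.1).sum ≤ len T := by
  classical
  set f : Seg d → ℝ := fun s => dist s.1 s.2 with hf
  set U : List (Seg d) := B.toList ++ (C.map fun c => c.2.1).flatten with hU
  have hUnd : U.Nodup := by
    rw [hU, List.nodup_append]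
    refine ⟨B.nodup_toList, ?_, ?_⟩
    · rw [List.nodup_flatten, List.pairwise_map]
      refine ⟨fun l hl => ?_, ?_⟩
      · obtain ⟨c, hc, rfl⟩ := List.mem_map.1 hl
        exact hg.int_nodup c hc
      · exact hg.int_disj.imp fun {c c'} h => fun w hw hw' => h w hw hw'
    · intro a ha b hb hab
      rw [Finset.mem_toList] at ha
      obtain ⟨l, hl, hbl⟩ := List.mem_flatten.1 hb
      obtain ⟨c, hc, rfl⟩ := List.mem_map.1 hl
      exact (hg.int_sub c hc b hbl).2 (hab ▸ ha)
  have hUS : ∀ u ∈ U, u ∈ T.toFinset := by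
    intro u hu
    rw [← hST]
    rcases List.mem_append.1 hu with hu | hu
    · exact hg.B_sub (Finset.mem_toList.1 hu)
    · obtain ⟨l, hl, hul⟩ := List.mem_flatten.1 hu
      obtain ⟨c, hc, rfl⟩ := List.mem_map.1 hl
      exact (hg.int_sub c hc u hul).1
  have h1 : (∑ b ∈ B, dist b.1 b.2) + (C.map fun c => len c.2.1).sum = (U.map f).sum := by
    rw [hU, List.map_append, List.sum_append, Finset.sum_map_toList, List.map_flatten, List.sum_flatten,
      List.map_map, List.map_map]
    congr 1
    rw [List.map_congr_left (fun c _ => len_eq_sum_map c.2.1)]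
    rfl
  have h2 : (U.map f).sum = ∑ u ∈ U.toFinset, f u := (List.sum_toFinset f hUnd).symm
  have h3 : ∑ u ∈ U.toFinset, f u ≤ ∑ u ∈ T.toFinset, f u :=
    Finset.sum_le_sum_of_subset_of_nonneg (fun u hu => hUS u (List.mem_toFinset.1 hu))
      fun u _ _ => dist_nonneg
  have h4 : ∑ u ∈ T.toFinset, f u ≤ (T.map f).sum := sum_toFinset_le_sum_map f (fun _ => dist_nonneg) T
  rw [h1, h2, len_eq_sum_map]
  exact h3.trans h4

/-- PART C — EVERY ADMISSIBLE GRAPH IS DOMINATED BY ONE WITH AT MOST `segBound |X|` SEGMENTS: keep whole the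
terminal and branch segments of a Steiner sub-structure of the intersection graph (§5) and replace each chain by
a short piece (§6); the result is admissible, not longer, and has at most 4|X|² + 2|X| + 1 segments. [cite: Balaban1987RG1, p.257 (linear size d_j, a shortest graph)] -/
theorem exists_admissible_length_le_segBound (X : Finset (Pt d)) {T : List (Seg d)} (hT : Admissible X T) :
    ∃ T', Admissible X T' ∧ T'.length ≤ segBound X.card ∧ len T' ≤ len T := by
  classical
  set S : Finset (Seg d) := T.toFinset with hS
  have hSsub : ∀ s ∈ S, segment ℝ s.1 s.2 ⊆ cubes X := fun s hs =>
    (segment_subset_carrier (List.mem_toFinset.1 hs)).trans hT.subset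
  -- the intersection graph of the segments of T is connected (§3)
  have hconn : ∀ a ∈ S, ∀ b ∈ S, ReflTransGen (SegAdj S) a b := by
    intro a ha b hb
    have hU : (⋃ i : (S : Set (Seg d)), segment ℝ i.1.1 i.1.2) = carrier T := by
      ext z
      simp only [Set.mem_iUnion, mem_carrier, Subtype.exists, Finset.mem_coe, exists_prop, hS,
        List.mem_toFinset]
    have hpre : IsPreconnected (⋃ i : (S : Set (Seg d)), segment ℝ i.1.1 i.1.2) := by
      rw [hU]; exact hT.connected.isPreconnected
    have h := reflTransGen_of_isPreconnected_iUnion hpre (fun i => isClosed_segment' i.1)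
      (fun i => ⟨i.1.1, left_mem_segment ℝ _ _⟩) ⟨a, ha⟩ ⟨b, hb⟩
    exact reflTransGen_map (p := SegAdj S) Subtype.val (fun i j hij => ReflTransGen.single ⟨hij, j.2⟩) h
  -- terminals: one segment of T in each cube of X
  have hterm : ∀ x ∈ X, ∃ s ∈ S, (segment ℝ s.1 s.2 ∩ cube x).Nonempty := by
    intro x hx
    obtain ⟨z, hz, hzx⟩ := hT.meets x hx
    obtain ⟨s, hs, hzs⟩ := mem_carrier.1 hz
    exact ⟨s, List.mem_toFinset.2 hs, z, hzs, hzx⟩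
  choose! τ hτS hτx using hterm
  obtain ⟨x₀, hx₀⟩ := hT.finset_nonempty
  set ts : List (Seg d) := X.toList.map τ with hts
  have htsS : ∀ t ∈ ts, t ∈ S := by
    intro t ht
    obtain ⟨x, hx, rfl⟩ := List.mem_map.1 ht
    exact hτS x (Finset.mem_toList.1 hx)
  have ht₀ : τ x₀ ∈ ts := List.mem_map.2 ⟨x₀, Finset.mem_toList.2 hx₀, rfl⟩
  have htslen : ts.length = X.card := by rw [hts, List.length_map, Finset.length_toList]
  -- the Steiner sub-structure (§5)
  obtain ⟨B, C, hg, htsB, hBcard, hClen⟩ :=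
    exists_good hconn (fun a b (h : SegAdj S a b) => h.2) ts htsS ht₀
  -- pieces for the chains (§6)
  obtain ⟨GP, hGPC, hGP⟩ := exists_pieces X hSsub C fun c hc => ⟨hg.B_sub (hg.ends c hc).1, hg.chain c hc⟩
  set T' : List (Seg d) := B.toList ++ (GP.map Prod.snd).flatten with hT'
  have hmemT' : ∀ z, z ∈ carrier T' ↔ (∃ b ∈ B, z ∈ segment ℝ b.1 b.2) ∨ ∃ p ∈ GP, z ∈ carrier p.2 := by
    intro z
    rw [hT', carrier_append, Set.mem_union, mem_carrier, mem_carrier_flatten]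
    simp only [Finset.mem_toList, List.mem_map, exists_exists_and_eq_and]
  have hCGP : ∀ c ∈ C, ∃ p ∈ GP, p.1 = c := by
    intro c hc
    rw [← hGPC] at hc
    obtain ⟨p, hp, rfl⟩ := List.mem_map.1 hc
    exact ⟨p, hp, rfl⟩
  have hB₀ : τ x₀ ∈ B := htsB _ ht₀
  refine ⟨T', ⟨?_, ?_, ?_⟩, ?_, ?_⟩
  · -- connected: index the pieces by B ⊕ GP
    let ι := Seg d ⊕ (Chain (Seg d) × List (Seg d))
    let t : Set ι := {i | match i with | Sum.inl b => b ∈ B | Sum.inr p => p ∈ GP}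
    let s : ι → Set (RPt d) := fun i => match i with
      | Sum.inl b => segment ℝ b.1 b.2
      | Sum.inr p => carrier p.2
    have hcarr : carrier T' = ⋃ i ∈ t, s i := by
      ext z
      rw [hmemT', Set.mem_iUnion₂]
      constructor
      · rintro (⟨b, hb, hz⟩ | ⟨p, hp, hz⟩)
        · exact ⟨Sum.inl b, hb, hz⟩
        · exact ⟨Sum.inr p, hp, hz⟩
      · rintro ⟨i, hi, hz⟩
        match i, hi, hz with
        | Sum.inl b, hb, hz => exact Or.inl ⟨b, hb, hz⟩
        | Sum.inr p, hp, hz => exact Or.inr ⟨p, hp, hz⟩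
    rw [hcarr]
    let K : ι → ι → Prop := fun i j => (s i ∩ s j).Nonempty ∧ i ∈ t
    -- every piece index is K-adjacent to the index of its first end segment, and kept ends are K-joined
    have hKpiece : ∀ p ∈ GP, ReflTransGen K (Sum.inr p) (Sum.inl p.1.1) ∧
        ReflTransGen K (Sum.inl p.1.1) (Sum.inr p) ∧ ReflTransGen K (Sum.inr p) (Sum.inl p.1.2.2) ∧
        ReflTransGen K (Sum.inl p.1.2.2) (Sum.inr p) := by
      intro p hp
      have hc : p.1 ∈ C := by rw [← hGPC]; exact List.mem_map.2 ⟨p, hp, rfl⟩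
      have h1 := (hGP p hp).meets_fst
      have h2 := (hGP p hp).meets_lst
      have hb : p.1.1 ∈ B := (hg.ends _ hc).1
      have hb' : p.1.2.2 ∈ B := (hg.ends _ hc).2
      refine ⟨ReflTransGen.single ⟨h1, hp⟩, ReflTransGen.single ⟨?_, hb⟩, ReflTransGen.single ⟨h2, hp⟩,
        ReflTransGen.single ⟨?_, hb'⟩⟩
      · rw [Set.inter_comm]; exact h1
      · rw [Set.inter_comm]; exact h2
    have hKlink : ∀ b b', Link C b b' → ReflTransGen K (Sum.inl b) (Sum.inl b') := by
      rintro b b' ⟨c, hc, h⟩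
      obtain ⟨p, hp, rfl⟩ := hCGP c hc
      obtain ⟨h1, h2, h3, h4⟩ := hKpiece p hp
      rcases h with ⟨rfl, rfl⟩ | ⟨rfl, rfl⟩
      · exact h2.trans h3
      · exact h4.trans h1
    have hKB : ∀ b ∈ B, ∀ b' ∈ B, ReflTransGen K (Sum.inl b) (Sum.inl b') :=
      fun b hb b' hb' => reflTransGen_map (p := K) Sum.inl hKlink (hg.conn b hb b' hb')
    -- reduce every index to a kept index
    have hred : ∀ i ∈ t, ∃ b ∈ B, ReflTransGen K i (Sum.inl b) ∧ ReflTransGen K (Sum.inl b) i := by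
      intro i hi
      match i, hi with
      | Sum.inl b, hb => exact ⟨b, hb, ReflTransGen.refl, ReflTransGen.refl⟩
      | Sum.inr p, hp =>
          have hc : p.1 ∈ C := by rw [← hGPC]; exact List.mem_map.2 ⟨p, hp, rfl⟩
          exact ⟨p.1.1, (hg.ends _ hc).1, (hKpiece p hp).1, (hKpiece p hp).2.1⟩
    refine IsConnected.biUnion_of_reflTransGen ⟨Sum.inl (τ x₀), hB₀⟩ ?_ ?_
    · intro i hi
      match i, hi with
      | Sum.inl b, _ => exact ⟨⟨b.1, left_mem_segment ℝ _ _⟩, (convex_segment _ _).isPreconnected⟩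
      | Sum.inr p, hp => exact (hGP p hp).connected
    · intro i hi j hj
      obtain ⟨b, hb, hib, -⟩ := hred i hi
      obtain ⟨b', hb', -, hb'j⟩ := hred j hj
      exact (hib.trans (hKB b hb b' hb')).trans hb'j
  · -- inside X
    intro z hz
    rcases (hmemT' z).1 hz with ⟨b, hb, hz⟩ | ⟨p, hp, hz⟩
    · exact hSsub b (hg.B_sub hb) hz
    · obtain ⟨g, hg', hzg⟩ := mem_carrier.1 hz
      exact (hGP p hp).subset g hg' hzg
  · -- meets every cube
    intro x hx
    obtain ⟨z, hzs, hzx⟩ := hτx x hx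
    have hB : τ x ∈ B := htsB _ (List.mem_map.2 ⟨x, Finset.mem_toList.2 hx, rfl⟩)
    exact ⟨z, (hmemT' z).2 (Or.inl ⟨τ x, hB, hzs⟩), hzx⟩
  · -- number of segments
    rw [hT', List.length_append, Finset.length_toList, List.length_flatten, List.map_map]
    have h1 : ((GP.map (List.length ∘ Prod.snd))).sum ≤ GP.length * (2 * X.card) := by
      have := List.sum_le_card_nsmul (GP.map (List.length ∘ Prod.snd)) (2 * X.card) (by
        intro n hn
        obtain ⟨p, hp, rfl⟩ := List.mem_map.1 hn
        exact (hGP p hp).length_le)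
      simpa using this
    have h2 : GP.length = C.length := by rw [← hGPC, List.length_map]
    rw [htslen] at hBcard hClen
    have h3 : GP.length * (2 * X.card) ≤ (2 * X.card) * (2 * X.card) :=
      Nat.mul_le_mul_right _ (h2 ▸ hClen)
    simp only [segBound]
    nlinarith [h1, h3, hBcard]
  · -- length
    rw [hT', len_append, len_flatten, List.map_map, len_eq_sum_map B.toList, Finset.sum_map_toList]
    have h1 : (GP.map (len ∘ Prod.snd)).sum ≤ (C.map fun c => len c.2.1).sum := by
      rw [← hGPC, List.map_map]
      apply List.sum_le_sum
      intro p hp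
      exact (hGP p hp).len_le
    have h2 := sum_kept_add_sum_interiors_le hg hS
    linarith

/-! ## §7. «A SHORTEST GRAPH»: the infimum `treeLen X` is attained -/

/-- THE INFIMUM d_j(X) IS A MINIMUM — [Balaban1987RG1] p. 257, verbatim: *"Consider a class of tree graphs contained
in X and intersecting all the cubes in X. A length of a shortest graph in this class, divided by M, is the linear
size of X"*: whenever the admissible class of X is non-empty, some admissible graph has length exactly
`treeLen X` (§6: lengths are dominated within the graphs with at most `segBound |X|` segments; §4: on that
bounded class the length attains its minimum). [cite: Balaban1987RG1, p.257 (linear size d_j, a shortest graph)] -/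
theorem exists_admissible_len_eq_treeLen {X : Finset (Pt d)} (hne : ∃ T, Admissible X T) :
    ∃ T, Admissible X T ∧ len T = treeLen X := by
  obtain ⟨T₀, hT₀⟩ := hne
  obtain ⟨T₁, hT₁, hT₁N, -⟩ := exists_admissible_length_le_segBound X hT₀
  obtain ⟨T, hT, -, hmin⟩ := exists_min_admissible_length_le X (segBound X.card) ⟨T₁, hT₁, hT₁N⟩
  refine ⟨T, hT, le_antisymm ?_ (treeLen_le_len hT)⟩
  refine le_treeLen ⟨T₀, hT₀⟩ fun T' hT' => ?_
  obtain ⟨T'', hT'', hT''N, hlen⟩ := exists_admissible_length_le_segBound X hT'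
  exact (hmin T'' hT'' hT''N).trans hlen

/-- The infimum is a member of the set of admissible lengths. [cite: Balaban1987RG1, p.257 (linear size d_j, a shortest graph)] -/
theorem treeLen_mem_lengths {X : Finset (Pt d)} (hne : ∃ T, Admissible X T) : treeLen X ∈ lengths X := by
  obtain ⟨T, hT, h⟩ := exists_admissible_len_eq_treeLen hne
  exact ⟨T, hT, h⟩

/-- «A SHORTEST GRAPH» FOR EVERY LOCALIZATION DOMAIN: for a non-empty face-connected family of cubes Y
(`TreeLength.exists_admissible`), some admissible graph has length d(Y) = `treeLen Y`. [cite: Balaban1987RG1, p.257 (linear size d_j, a shortest graph)] -/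
theorem exists_shortest_graph {Y : Finset (Pt d)} (hY : Y.Nonempty) (hc : FaceConnected Y) :
    ∃ T, Admissible Y T ∧ len T = treeLen Y := by
  obtain ⟨T, hT, -⟩ := exists_admissible hY hc
  exact exists_admissible_len_eq_treeLen ⟨T, hT⟩

/-- A shortest graph may moreover be taken with at most `segBound |X|` = 4|X|² + 2|X| + 1 segments. [cite: Balaban1987RG1, p.257 (linear size d_j, a shortest graph)] -/
theorem exists_shortest_graph_length_le {X : Finset (Pt d)} (hne : ∃ T, Admissible X T) :
    ∃ T, Admissible X T ∧ len T = treeLen X ∧ T.length ≤ segBound X.card := by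
  obtain ⟨T, hT, hlen⟩ := exists_admissible_len_eq_treeLen hne
  obtain ⟨T', hT', hN, hle⟩ := exists_admissible_length_le_segBound X hT
  exact ⟨T', hT', le_antisymm (hlen ▸ hle) (treeLen_le_len hT'), hN⟩

/-! ## §8 (revision v1.1, append-only). The STEINER LENGTH ℓ̃ of [Dimock2013BalabanII] App. E is attained as well

[Dimock2013BalabanII] App. E, verbatim: *"M ℓ̃_M(Y) is the length of a minimal tree whose vertices are one point from
each block in Y and possibly other points."* — `TreeLength.steinerLen Y` was typed as the infimum of the lengths of
the Steiner-admissible graphs (`SAdmissible`: connected, meeting every cube of Y, NOT confined to Y), attainment left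
open (`TreeLength` header, revision v2: «NOT asserted in v2: … attainment of the infima»).  The same route as §§4–7
applies with two changes: a chain is now realised by ONE free segment joining its two threaded endpoints (no
containment constraint, so no shortcutting inside cubes is needed), and compactness comes from a length bound (a
connected graph of length ≤ L through a cube of Y stays within sup-distance L + 1 of that cube's corner — the capture
lemma `TreeLength.le_lenIn_closedBall`; the diameter bound is the landed `B12Decay510Window.dist_le_len`, re-derived
inline below so that this file keeps importing `TreeLength` only). -/

/-- A STEINER PIECE realising a chain (b, I, b'): ONE segment joining a point of b to a point of b', not longer than
the interior I. [cite: Dimock2013BalabanII, App. E (preamble of Lemma E.1)] -/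
structure SPiece (c : Chain (Seg d)) (g : List (Seg d)) : Prop where
  /-- connected -/
  connected : IsConnected (carrier g)
  /-- meets the first end segment -/
  meets_fst : (carrier g ∩ segment ℝ c.1.1 c.1.2).Nonempty
  /-- meets the last end segment -/
  meets_lst : (carrier g ∩ segment ℝ c.2.2.1 c.2.2.2).Nonempty
  /-- not longer than the interior -/
  len_le : len g ≤ len c.2.1
  /-- one segment -/
  length_le : g.length ≤ 1

/-- EXISTENCE OF STEINER PIECES: thread points through the chain and join the first to the last threaded point by one
segment (polygonal triangle inequality + `thread_len`). [cite: Dimock2013BalabanII, App. E (preamble of Lemma E.1)] -/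
theorem exists_sPiece {S : Finset (Seg d)} (c : Chain (Seg d))
    (hch : List.IsChain (SegAdj S) (c.1 :: (c.2.1 ++ [c.2.2]))) : ∃ g, SPiece c g := by
  obtain ⟨b, I, b'⟩ := c
  simp only at hch ⊢
  obtain ⟨P, hP⟩ := exists_thread (fun _ _ h => h.1) _ hch
  have hne : I ++ [b'] ≠ [] := by simp
  obtain ⟨w₁, L₁, hwL⟩ := List.exists_cons_of_ne_nil hne
  have hP2 := hP
  rw [hwL] at hP2
  obtain ⟨hPne, hheadb, -⟩ := thread_head hP2
  obtain ⟨hPne', hlast⟩ := thread_getLast (I ++ [b']) b P hP hne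
  rw [List.getLast_append_of_ne_nil _ (List.cons_ne_nil _ _)] at hlast
  simp only [List.getLast_singleton] at hlast
  refine ⟨[(P.head hPne, P.getLast hPne)], ?_, ?_, ?_, ?_, ?_⟩
  · simp only [carrier_cons, carrier_nil, Set.union_empty]
    exact ⟨⟨_, left_mem_segment ℝ _ _⟩, (convex_segment _ _).isPreconnected⟩
  · refine ⟨P.head hPne, ?_, hheadb⟩
    simp only [carrier_cons, carrier_nil, Set.union_empty]
    exact left_mem_segment ℝ _ _
  · refine ⟨P.getLast hPne, ?_, by convert hlast⟩
    simp only [carrier_cons, carrier_nil, Set.union_empty]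
    exact right_mem_segment ℝ _ _
  · rw [len_cons, len_nil, add_zero]
    exact (dist_head_getLast_le_len P hPne).trans (thread_len I b b' P hP)
  · simp

/-- Steiner pieces for all chains of a list. [cite: Dimock2013BalabanII, App. E (preamble of Lemma E.1)] -/
theorem exists_sPieces {S : Finset (Seg d)} :
    ∀ (C : List (Chain (Seg d))), (∀ c ∈ C, List.IsChain (SegAdj S) (c.1 :: (c.2.1 ++ [c.2.2]))) →
      ∃ GP : List (Chain (Seg d) × List (Seg d)), GP.map Prod.fst = C ∧ ∀ p ∈ GP, SPiece p.1 p.2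
  | [], _ => ⟨[], rfl, by simp⟩
  | c :: C, h => by
      obtain ⟨g, hg⟩ := exists_sPiece (S := S) c (h c List.mem_cons_self)
      obtain ⟨GP, hGP, hP⟩ := exists_sPieces (S := S) C fun c' hc' => h c' (List.mem_cons_of_mem _ hc')
      refine ⟨(c, g) :: GP, by simp [hGP], ?_⟩
      intro p hp
      rcases List.mem_cons.1 hp with rfl | hp
      · exact hg
      · exact hP p hp

/-- ASSEMBLY (connectedness): kept segments of a good Steiner structure together with one connected piece per chain,
each piece meeting the two end segments of its chain, form a connected graph. [cite: Dimock2013BalabanII, App. E (preamble of Lemma E.1)] -/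
theorem isConnected_carrier_assembly {Q : Seg d → Seg d → Prop} {S B : Finset (Seg d)} {C : List (Chain (Seg d))}
    (hg : Good Q S B C) (hB : B.Nonempty) (GP : List (Chain (Seg d) × List (Seg d))) (hGPC : GP.map Prod.fst = C)
    (hconn : ∀ p ∈ GP, IsConnected (carrier p.2))
    (hfst : ∀ p ∈ GP, (carrier p.2 ∩ segment ℝ p.1.1.1 p.1.1.2).Nonempty)
    (hlst : ∀ p ∈ GP, (carrier p.2 ∩ segment ℝ p.1.2.2.1 p.1.2.2.2).Nonempty) :
    IsConnected (carrier (B.toList ++ (GP.map Prod.snd).flatten)) := by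
  classical
  have hmemT' : ∀ z, z ∈ carrier (B.toList ++ (GP.map Prod.snd).flatten) ↔
      (∃ b ∈ B, z ∈ segment ℝ b.1 b.2) ∨ ∃ p ∈ GP, z ∈ carrier p.2 := by
    intro z
    rw [carrier_append, Set.mem_union, mem_carrier, mem_carrier_flatten]
    simp only [Finset.mem_toList, List.mem_map, exists_exists_and_eq_and]
  have hCGP : ∀ c ∈ C, ∃ p ∈ GP, p.1 = c := by
    intro c hc
    rw [← hGPC] at hc
    obtain ⟨p, hp, rfl⟩ := List.mem_map.1 hc
    exact ⟨p, hp, rfl⟩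
  let ι := Seg d ⊕ (Chain (Seg d) × List (Seg d))
  let t : Set ι := {i | match i with | Sum.inl b => b ∈ B | Sum.inr p => p ∈ GP}
  let s : ι → Set (RPt d) := fun i => match i with
    | Sum.inl b => segment ℝ b.1 b.2
    | Sum.inr p => carrier p.2
  have hcarr : carrier (B.toList ++ (GP.map Prod.snd).flatten) = ⋃ i ∈ t, s i := by
    ext z
    rw [hmemT', Set.mem_iUnion₂]
    constructor
    · rintro (⟨b, hb, hz⟩ | ⟨p, hp, hz⟩)
      · exact ⟨Sum.inl b, hb, hz⟩
      · exact ⟨Sum.inr p, hp, hz⟩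
    · rintro ⟨i, hi, hz⟩
      match i, hi, hz with
      | Sum.inl b, hb, hz => exact Or.inl ⟨b, hb, hz⟩
      | Sum.inr p, hp, hz => exact Or.inr ⟨p, hp, hz⟩
  rw [hcarr]
  let K : ι → ι → Prop := fun i j => (s i ∩ s j).Nonempty ∧ i ∈ t
  have hKpiece : ∀ p ∈ GP, ReflTransGen K (Sum.inr p) (Sum.inl p.1.1) ∧
      ReflTransGen K (Sum.inl p.1.1) (Sum.inr p) ∧ ReflTransGen K (Sum.inr p) (Sum.inl p.1.2.2) ∧
      ReflTransGen K (Sum.inl p.1.2.2) (Sum.inr p) := by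
    intro p hp
    have hc : p.1 ∈ C := by rw [← hGPC]; exact List.mem_map.2 ⟨p, hp, rfl⟩
    have h1 := hfst p hp
    have h2 := hlst p hp
    have hb : p.1.1 ∈ B := (hg.ends _ hc).1
    have hb' : p.1.2.2 ∈ B := (hg.ends _ hc).2
    refine ⟨ReflTransGen.single ⟨h1, hp⟩, ReflTransGen.single ⟨?_, hb⟩, ReflTransGen.single ⟨h2, hp⟩,
      ReflTransGen.single ⟨?_, hb'⟩⟩
    · rw [Set.inter_comm]; exact h1
    · rw [Set.inter_comm]; exact h2
  have hKlink : ∀ b b', Link C b b' → ReflTransGen K (Sum.inl b) (Sum.inl b') := by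
    rintro b b' ⟨c, hc, h⟩
    obtain ⟨p, hp, rfl⟩ := hCGP c hc
    obtain ⟨h1, h2, h3, h4⟩ := hKpiece p hp
    rcases h with ⟨rfl, rfl⟩ | ⟨rfl, rfl⟩
    · exact h2.trans h3
    · exact h4.trans h1
  have hKB : ∀ b ∈ B, ∀ b' ∈ B, ReflTransGen K (Sum.inl b) (Sum.inl b') :=
    fun b hb b' hb' => reflTransGen_map (p := K) Sum.inl hKlink (hg.conn b hb b' hb')
  have hred : ∀ i ∈ t, ∃ b ∈ B, ReflTransGen K i (Sum.inl b) ∧ ReflTransGen K (Sum.inl b) i := by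
    intro i hi
    match i, hi with
    | Sum.inl b, hb => exact ⟨b, hb, ReflTransGen.refl, ReflTransGen.refl⟩
    | Sum.inr p, hp =>
        have hc : p.1 ∈ C := by rw [← hGPC]; exact List.mem_map.2 ⟨p, hp, rfl⟩
        exact ⟨p.1.1, (hg.ends _ hc).1, (hKpiece p hp).1, (hKpiece p hp).2.1⟩
  obtain ⟨b₀, hb₀⟩ := hB
  refine IsConnected.biUnion_of_reflTransGen ⟨Sum.inl b₀, hb₀⟩ ?_ ?_
  · intro i hi
    match i, hi with
    | Sum.inl b, _ => exact ⟨⟨b.1, left_mem_segment ℝ _ _⟩, (convex_segment _ _).isPreconnected⟩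
    | Sum.inr p, hp => exact hconn p hp
  · intro i hi j hj
    obtain ⟨b, hb, hib, -⟩ := hred i hi
    obtain ⟨b', hb', -, hb'j⟩ := hred j hj
    exact (hib.trans (hKB b hb b' hb')).trans hb'j

/-- STEINER REALISATION: every Steiner-admissible graph is dominated by a Steiner-admissible graph with at most
4|Y| + 1 segments (2|Y| + 1 kept segments and one free segment per chain). [cite: Dimock2013BalabanII, App. E (preamble of Lemma E.1)] -/
theorem exists_sAdmissible_length_le (Y : Finset (Pt d)) {T : List (Seg d)} (hT : SAdmissible Y T) :
    ∃ T', SAdmissible Y T' ∧ T'.length ≤ 4 * Y.card + 1 ∧ len T' ≤ len T := by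
  classical
  set S : Finset (Seg d) := T.toFinset with hS
  have hconn : ∀ a ∈ S, ∀ b ∈ S, ReflTransGen (SegAdj S) a b := by
    intro a ha b hb
    have hU : (⋃ i : (S : Set (Seg d)), segment ℝ i.1.1 i.1.2) = carrier T := by
      ext z
      simp only [Set.mem_iUnion, mem_carrier, Subtype.exists, Finset.mem_coe, exists_prop, hS,
        List.mem_toFinset]
    have hpre : IsPreconnected (⋃ i : (S : Set (Seg d)), segment ℝ i.1.1 i.1.2) := by
      rw [hU]; exact hT.connected.isPreconnected
    have h := reflTransGen_of_isPreconnected_iUnion hpre (fun i => isClosed_segment' i.1)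
      (fun i => ⟨i.1.1, left_mem_segment ℝ _ _⟩) ⟨a, ha⟩ ⟨b, hb⟩
    exact reflTransGen_map (p := SegAdj S) Subtype.val (fun i j hij => ReflTransGen.single ⟨hij, j.2⟩) h
  have hterm : ∀ y ∈ Y, ∃ s ∈ S, (segment ℝ s.1 s.2 ∩ cube y).Nonempty := by
    intro y hy
    obtain ⟨z, hz, hzy⟩ := hT.meets y hy
    obtain ⟨s, hs, hzs⟩ := mem_carrier.1 hz
    exact ⟨s, List.mem_toFinset.2 hs, z, hzs, hzy⟩
  choose! τ hτS hτy using hterm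
  -- Y is non-empty since the carrier is; but Y may be empty while the class is non-empty: treat Y = ∅ apart
  rcases Y.eq_empty_or_nonempty with hY0 | ⟨y₀, hy₀⟩
  · -- Y = ∅: a single degenerate segment at a point of T is Steiner-admissible
    obtain ⟨z, hz⟩ := hT.connected.nonempty
    refine ⟨[(z, z)], ⟨?_, by simp [hY0]⟩, by simp [hY0], ?_⟩
    · simp only [carrier_cons, carrier_nil, Set.union_empty, segment_same]
      exact isConnected_singleton
    · rw [len_cons, len_nil, dist_self]
      simpa using len_nonneg T
  set ts : List (Seg d) := Y.toList.map τ with hts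
  have htsS : ∀ t ∈ ts, t ∈ S := by
    intro t ht
    obtain ⟨y, hy, rfl⟩ := List.mem_map.1 ht
    exact hτS y (Finset.mem_toList.1 hy)
  have ht₀ : τ y₀ ∈ ts := List.mem_map.2 ⟨y₀, Finset.mem_toList.2 hy₀, rfl⟩
  have htslen : ts.length = Y.card := by rw [hts, List.length_map, Finset.length_toList]
  obtain ⟨B, C, hg, htsB, hBcard, hClen⟩ :=
    exists_good hconn (fun a b (h : SegAdj S a b) => h.2) ts htsS ht₀
  obtain ⟨GP, hGPC, hGP⟩ := exists_sPieces (S := S) C fun c hc => hg.chain c hc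
  have hB₀ : τ y₀ ∈ B := htsB _ ht₀
  set T' : List (Seg d) := B.toList ++ (GP.map Prod.snd).flatten with hT'
  refine ⟨T', ⟨?_, ?_⟩, ?_, ?_⟩
  · exact isConnected_carrier_assembly hg ⟨_, hB₀⟩ GP hGPC (fun p hp => (hGP p hp).connected)
      (fun p hp => (hGP p hp).meets_fst) (fun p hp => (hGP p hp).meets_lst)
  · intro y hy
    obtain ⟨z, hzs, hzy⟩ := hτy y hy
    have hB : τ y ∈ B := htsB _ (List.mem_map.2 ⟨y, Finset.mem_toList.2 hy, rfl⟩)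
    refine ⟨z, ?_, hzy⟩
    rw [hT', carrier_append]
    exact Or.inl (segment_subset_carrier (Finset.mem_toList.2 hB) hzs)
  · rw [hT', List.length_append, Finset.length_toList, List.length_flatten, List.map_map]
    have h1 : ((GP.map (List.length ∘ Prod.snd))).sum ≤ GP.length * 1 := by
      have := List.sum_le_card_nsmul (GP.map (List.length ∘ Prod.snd)) 1 (by
        intro n hn
        obtain ⟨p, hp, rfl⟩ := List.mem_map.1 hn
        exact (hGP p hp).length_le)
      simpa using this
    have h2 : GP.length = C.length := by rw [← hGPC, List.length_map]
    rw [htslen] at hBcard hClen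
    omega
  · rw [hT', len_append, len_flatten, List.map_map, len_eq_sum_map B.toList, Finset.sum_map_toList]
    have h1 : (GP.map (len ∘ Prod.snd)).sum ≤ (C.map fun c => len c.2.1).sum := by
      rw [← hGPC, List.map_map]
      apply List.sum_le_sum
      intro p hp
      exact (hGP p hp).len_le
    have h2 := sum_kept_add_sum_interiors_le hg hS
    linarith

/-- For N ≥ 1 segments, Steiner-admissibility is a CLOSED condition on the configuration. [cite: Dimock2013BalabanII, App. E (preamble of Lemma E.1)] -/
theorem isClosed_setOf_sAdmissible (Y : Finset (Pt d)) {N : ℕ} (hN : 0 < N) :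
    IsClosed {f : Config d N | SAdmissible Y (List.ofFn f)} := by
  have hset : {f : Config d N | SAdmissible Y (List.ofFn f)} =
      {f | GraphConn f} ∩ ⋂ y ∈ (Y : Set (Pt d)), {f | (carrier (List.ofFn f) ∩ cube y).Nonempty} := by
    ext f
    simp only [Set.mem_setOf_eq, Set.mem_inter_iff, Set.mem_iInter, Finset.mem_coe]
    constructor
    · intro h
      exact ⟨(isConnected_carrier_ofFn_iff hN f).1 h.connected, h.meets⟩
    · rintro ⟨h1, h3⟩
      exact ⟨(isConnected_carrier_ofFn_iff hN f).2 h1, h3⟩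
  rw [hset]
  exact (isClosed_setOf_graphConn N).inter (isClosed_biInter fun y _ => isClosed_setOf_carrier_meets isClosed_Icc)

/-- LOCALISATION: a Steiner-admissible graph for Y ∋ y₀ of length ≤ L lies in the closed sup-ball of radius L + 1
about the corner of the cube y₀ (diameter bound). [cite: Dimock2013BalabanII, App. E (preamble of Lemma E.1)] -/
theorem carrier_subset_closedBall_of_sAdmissible {Y : Finset (Pt d)} {T : List (Seg d)} (hT : SAdmissible Y T)
    {y₀ : Pt d} (hy₀ : y₀ ∈ Y) {L : ℝ} (hL : len T ≤ L) :
    carrier T ⊆ Metric.closedBall (corner y₀) (L + 1) := by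
  intro z hz
  obtain ⟨w, hw, hwy⟩ := hT.meets y₀ hy₀
  rw [Metric.mem_closedBall]
  -- diameter bound dist z w ≤ len T (the landed `B12Decay510Window.dist_le_len`, re-derived here from the capture
  -- lemma `TreeLength.le_lenIn_closedBall` to keep the imports of this file at `TreeLength` only)
  have h1 : dist z w ≤ len T := by
    by_contra h
    push Not at h
    have hρ : 0 < dist z w := (len_nonneg T).trans_lt h
    have h3 := le_lenIn_closedBall hT.connected.isPreconnected hz hw hρ le_rfl
    have h4 : lenIn (Metric.closedBall z (dist z w)) T ≤ len T := by
      have := sum_lenIn_le_len ({0} : Finset ℕ) (fun _ => Metric.closedBall z (dist z w))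
        (fun _ _ => Metric.isClosed_closedBall) (by simp) T
      simpa using this
    linarith
  have h2 : dist w (corner y₀) ≤ 1 := dist_le_one_of_mem_cube hwy (corner_mem_cube y₀)
  linarith [dist_triangle z w (corner y₀)]

/-- STEINER PADDING: appending degenerate segments at a point of the graph keeps it Steiner-admissible, with the
same length. [cite: Dimock2013BalabanII, App. E (preamble of Lemma E.1)] -/
theorem sAdmissible_pad {Y : Finset (Pt d)} {T : List (Seg d)} (hT : SAdmissible Y T) {p : RPt d}
    (hp : p ∈ carrier T) (m : ℕ) :
    SAdmissible Y (T ++ List.replicate m (p, p)) ∧ len (T ++ List.replicate m (p, p)) = len T := by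
  have hc : carrier (T ++ List.replicate m (p, p)) = carrier T := by
    rw [carrier_append]
    exact Set.union_eq_self_of_subset_right
      ((carrier_replicate_subset p m).trans (Set.singleton_subset_iff.2 hp))
  refine ⟨⟨?_, ?_⟩, ?_⟩
  · rw [hc]; exact hT.connected
  · rw [hc]; exact hT.meets
  · rw [len_append, len_replicate, add_zero]

/-- A Steiner-admissible graph with at most N segments can be padded to a Steiner-admissible configuration of exactly
N segments with the same length. [cite: Dimock2013BalabanII, App. E (preamble of Lemma E.1)] -/
theorem exists_config_of_sAdmissible {Y : Finset (Pt d)} {T : List (Seg d)} (hT : SAdmissible Y T) {N : ℕ}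
    (hN : T.length ≤ N) : ∃ f : Config d N, SAdmissible Y (List.ofFn f) ∧ len (List.ofFn f) = len T := by
  obtain ⟨p, hp⟩ := hT.connected.nonempty
  obtain ⟨hA, hlen⟩ := sAdmissible_pad hT hp (N - T.length)
  have hLN : (T ++ List.replicate (N - T.length) (p, p)).length = N := by
    rw [List.length_append, List.length_replicate]
    omega
  let f : Config d N := fun i => (T ++ List.replicate (N - T.length) (p, p)).get (i.cast hLN.symm)
  have hf : List.ofFn f = T ++ List.replicate (N - T.length) (p, p) := by
    apply List.ext_getElem
    · rw [List.length_ofFn, hLN]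
    · intro k h1 h2
      rw [List.getElem_ofFn]
      simp [f]
  refine ⟨f, ?_, ?_⟩
  · rw [hf]; exact hA
  · rw [hf]; exact hlen

/-- MINIMUM OVER STEINER-ADMISSIBLE GRAPHS OF BOUNDED COMPLEXITY: among the Steiner-admissible graphs with at most N
segments (if any) there is one of least length (closed conditions + the length bound confine the relevant
configurations to a compact set). [cite: Dimock2013BalabanII, App. E (preamble of Lemma E.1)] -/
theorem exists_min_sAdmissible_length_le (Y : Finset (Pt d)) (N : ℕ)
    (hne : ∃ T, SAdmissible Y T ∧ T.length ≤ N) :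
    ∃ T, SAdmissible Y T ∧ T.length ≤ N ∧ ∀ T', SAdmissible Y T' → T'.length ≤ N → len T ≤ len T' := by
  obtain ⟨T₀, hT₀, hT₀N⟩ := hne
  have hN : 0 < N := by
    have h1 : T₀ ≠ [] := by
      intro h
      have := hT₀.connected.nonempty
      rw [h, carrier_nil] at this
      exact Set.not_nonempty_empty this
    have := List.length_pos_iff.2 h1
    omega
  rcases Y.eq_empty_or_nonempty with hY0 | ⟨y₀, hy₀⟩
  · -- Y = ∅ : the one-point graph has length 0 and is Steiner-admissible
    obtain ⟨z, hz⟩ := hT₀.connected.nonempty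
    refine ⟨[(z, z)], ⟨?_, by simp [hY0]⟩, by simp; omega, fun T' _ _ => ?_⟩
    · simp only [carrier_cons, carrier_nil, Set.union_empty, segment_same]
      exact isConnected_singleton
    · rw [len_cons, len_nil, dist_self]
      simpa using len_nonneg T'
  set L := len T₀ with hLdef
  let A : Set (Config d N) := {f | SAdmissible Y (List.ofFn f) ∧ len (List.ofFn f) ≤ L}
  have hAclosed : IsClosed A :=
    (isClosed_setOf_sAdmissible Y hN).inter (isClosed_le (continuous_len_ofFn N) continuous_const)
  have hK : IsCompact (Set.pi Set.univ fun _ : Fin N =>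
      Metric.closedBall (corner y₀) (L + 1) ×ˢ Metric.closedBall (corner y₀) (L + 1)) :=
    isCompact_univ_pi fun _ => (isCompact_closedBall _ _).prod (isCompact_closedBall _ _)
  have hAcpt : IsCompact A := by
    refine hK.of_isClosed_subset hAclosed fun f hf => ?_
    simp only [Set.mem_pi, Set.mem_univ, Set.mem_prod, forall_true_left]
    intro i
    have hsub := carrier_subset_closedBall_of_sAdmissible hf.1 hy₀ hf.2
    have hs : segment ℝ (f i).1 (f i).2 ⊆ carrier (List.ofFn f) := fun z hz => mem_carrier_ofFn.2 ⟨i, hz⟩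
    exact ⟨hsub (hs (left_mem_segment ℝ _ _)), hsub (hs (right_mem_segment ℝ _ _))⟩
  obtain ⟨f₀, hf₀, hf₀len⟩ := exists_config_of_sAdmissible hT₀ hT₀N
  have hAne : A.Nonempty := ⟨f₀, hf₀, by rw [hf₀len]⟩
  obtain ⟨f, hf, hmin⟩ := hAcpt.exists_isMinOn hAne (continuous_len_ofFn N).continuousOn
  refine ⟨List.ofFn f, hf.1, by simp, fun T' hT' hT'N => ?_⟩
  by_cases hle : len T' ≤ L
  · obtain ⟨g, hg, hglen⟩ := exists_config_of_sAdmissible hT' hT'N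
    rw [← hglen]
    exact hmin ⟨hg, by rw [hglen]; exact hle⟩
  · push Not at hle
    exact (hf.2.trans hle.le)

/-- THE STEINER LENGTH IS A MINIMUM — [Dimock2013BalabanII] App. E «the length of a MINIMAL tree»: whenever Y has a
Steiner-admissible graph, some Steiner-admissible graph has length exactly `steinerLen Y`. [cite: Dimock2013BalabanII, App. E (preamble of Lemma E.1)] -/
theorem exists_sAdmissible_len_eq_steinerLen {Y : Finset (Pt d)} (hne : ∃ T, SAdmissible Y T) :
    ∃ T, SAdmissible Y T ∧ len T = steinerLen Y := by
  obtain ⟨T₀, hT₀⟩ := hne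
  obtain ⟨T₁, hT₁, hT₁N, -⟩ := exists_sAdmissible_length_le Y hT₀
  obtain ⟨T, hT, -, hmin⟩ := exists_min_sAdmissible_length_le Y (4 * Y.card + 1) ⟨T₁, hT₁, hT₁N⟩
  refine ⟨T, hT, le_antisymm ?_ (steinerLen_le_len hT)⟩
  refine le_steinerLen ⟨T₀, hT₀⟩ fun T' hT' => ?_
  obtain ⟨T'', hT'', hT''N, hlen⟩ := exists_sAdmissible_length_le Y hT'
  exact (hmin T'' hT'' hT''N).trans hlen

/-- «A MINIMAL TREE» for every non-empty family of cubes Y: some Steiner-admissible graph has length ℓ̃(Y) =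
`steinerLen Y`, and it may be taken with at most 4|Y| + 1 segments. [cite: Dimock2013BalabanII, App. E (preamble of Lemma E.1)] -/
theorem exists_steiner_graph {Y : Finset (Pt d)} (hY : Y.Nonempty) :
    ∃ T, SAdmissible Y T ∧ len T = steinerLen Y ∧ T.length ≤ 4 * Y.card + 1 := by
  obtain ⟨T, hT, hlen⟩ := exists_sAdmissible_len_eq_steinerLen (exists_sAdmissible hY)
  obtain ⟨T', hT', hN, hle⟩ := exists_sAdmissible_length_le Y hT
  exact ⟨T', hT', le_antisymm (hlen ▸ hle) (steinerLen_le_len hT'), hN⟩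

end

end Literature.MathematicalPhysics.QuantumFieldTheory.Balaban1983to89.B12ShortestGraph257
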